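import Mathlib.MeasureTheory.Function.LpSeminorm.Basic
import Mathlib.MeasureTheory.Function.LocallyIntegrable
import Literature.Analysis.FluidPDE.SelfSimilar
import Literature.Analysis.FluidPDE.MildSolution
import Literature.Analysis.FluidPDE.SuitableWeak
import Literature.Analysis.FluidPDE.AxisymmetricEuler
import Literature.Analysis.FluidPDE.NSWave0
import HarnessLib
import HarnessLib.Audit

-- provenance: harness21/H21/H21/Statements/NS/SelfSimilarLiouville.lean @ 89e2818 (interim HEAD d8f2665); M5 mechanical rewrite
/-!
# Self-similar blow-up, Liouville theorems and ancient solutions of Navier–Stokes on `ℝ³`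
(family: NS, statements **ns.S21**, **ns.S22**, **ns.S25**, **ns.S26**; trunk FluidKinetic,
outline `H21/Outlines/FluidKinetic.md`, item `NSSelfSimilarLiouville`; namespace `Literature.NS`,
coexisting with the accepted `Statements/NS/Wave0.lean` and `Statements/NS/Axisymmetric.lean`)

Physical space is `ℝ³ = EuclideanSpace ℝ (Fin 3)`; velocities are `u : ℝ → ℝ³ → ℝ³` (time
first). All the vocabulary is the accepted prelude `Prelude/FluidKinetic/SelfSimilar`
(`Fluid.nsRescale`, `Fluid.nsRescaleData`, `Fluid.lerayBackward`, `Fluid.IsLerayProfile`,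
`Fluid.IsSelfSimilar`, `Fluid.IsDiscretelySelfSimilar`, `Fluid.IsRotatedDSS`,
`Fluid.IsAncientMildSolution`, `Fluid.IsBoundedAncientMildSolution`, `Fluid.HasTypeIDecay`),
`AxisymmetricEuler` (`Fluid.IsAxisymmetric`, `Fluid.HasNoSwirl`, `Fluid.swirl`,
`Fluid.cylRadius`), `ClassicalSolution` (`Fluid.IsClassicalNSSolutionOn`), `WeakSolution`
(`Fluid.IsWeakNSSolutionOn`, `Fluid.slab`), `SuitableWeak` (`Fluid.IsSuitableWeakSolutionOn`),
`VectorCalculus` (`Fluid.IsDivFree`, `Fluid.IsWeaklyDivFree`, `Fluid.frobeniusNormSq`) and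
`Statements/NS/Wave0` (`NS.HasRapidSpatialDecay`, `NS.HasBoundedEnergy`).
(`Fluid.nsRescale` is letter for letter the accepted `NS.rescale` of `Statements/NS/CriticalSpaces`,
which is deliberately *not* imported here; the `rfl` bridge lives in
`Statements/NS/CriticalRegularity.lean`.)

## Contents

* **ns.S21** `NS.necas_ruzicka_sverak`: a backward self-similar (Leray) profile `U ∈ L³(ℝ³)`
  vanishes (Nečas–Růžička–Šverák 1996, Thm 1); `NS.tsai_selfsimilar`: the same for
  `U ∈ L^q(ℝ³)`, `3 < q < ∞` (Tsai 1998, Thm 1); `NS.tsai_selfsimilar_local_energy`: the same if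
  the self-similar solution `u = lerayBackward a T U` satisfies the local energy estimates near
  the putative singularity `(0, T)` (Tsai 1998, Thm 2).
* **ns.S22** `NS.LiouvilleConjectureNS` (`def … : Prop`, open; Seregin–Šverák 2009, conjecture
  (L); Koch–Nadirashvili–Seregin–Šverák 2009, §1): bounded ancient mild solutions on
  `ℝ³ × (−∞, 0)` are constant; the two proved cases `NS.knss_axisymmetric_no_swirl` (KNSS 2009,
  Thm 5.2) and `NS.knss_bound_C_over_r` (KNSS 2009, Thm 5.3) as `theorem`s. (The name keeps the
  `NS` suffix of the outline's planned declaration list although it sits in `namespace Literature.NS`.)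
* **ns.S26** `NS.TypeIDSSLiouville λ`, `NS.RotatedTypeIDSSLiouville λ R` and the wall
  `NS.TypeIDSSLiouvilleConjecture` (all `λ > 1`, all `R`) (`def … : Prop`, flag wall
  `summits/ns-w-typeI-dss-liouville`; Bradshaw–Tsai 2017 (CPDE), Open Problem 5.1; Tsai GSM
  192, Conj. 8.8–8.9): Type I ancient mild
  (`λ`-DSS, resp. rotated `λ`-DSS) solutions vanish (the wall is a transitional duplicate of the
  canonical `Summit.NavierStokesRegularity.NavierStokesRegularity.TypeIDSSLiouvilleConjecture`,
  see its docstring; `typeIDSSLiouvilleConjecture_iff` moved to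
  `SelfSimilarLiouvilleConsequences.lean`); the real lemma
  `NS.rotatedTypeIDSSLiouville_refl_iff`; and the (forward) existence side for `λ`-DSS data in
  `L²_loc(ℝ³)`, every `λ > 1`: `NS.chae_wolf_dss_existence` (historical name, kept; the
  statement — `λ`-DSS *suitable* weak solutions — is Bradshaw–Tsai 2019, Thm 1.2, not
  Chae–Wolf's theorem), its fuller rendering `NS.bradshawTsai2019_dss_existence`, and
  `NS.chaeWolf2018_dss_existence` (Chae–Wolf 2018, Thm 1.4: `λ`-DSS local Leray solutions *with
  projected pressure*); the implications `chae_wolf_dss_existence_of_bradshawTsai2019` and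
  `chaeWolf2018_dss_existence_of_bradshawTsai2019` are proved.
* **ns.S25** `NS.AxisymmetricSwirlRegularity` (`def … : Prop`, wall AX: global regularity for
  axisymmetric Schwartz-type data *with* swirl) and `NS.AxisymmetricLiouvilleBoundedSwirl`
  (`def … : Prop`, wall AX-L: bounded ancient mild axisymmetric solutions with bounded swirl
  `Γ = r u_θ` are constant; **open problem**: the axisymmetric case of conjecture (L), stated
  open in KNSS 2009, §5, arXiv p. 10 ("The validity of Theorem 5.2 in the absence of the 'no
  swirl' assumption is still an open problem"), in the bounded-`Γ` form of Lei–Ren–Zhang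
  arXiv:1902.11229, §1; still open according to the Zhang–Pan review (Anal. Theory Appl. 38
  (2022), §3); partial results listed in the docstring).
* **ns.S25, the sub-cases of (AX-L) proved in print**, as named facts in the class of
  `NS.AxisymmetricLiouvilleBoundedSwirl`: `leiZhangZhao2017_liouville_swirl_Lp` (Lei–Zhang–Zhao
  2017, Thm 1.3: `Γ ∈ L^∞_t L^p_x`, `p < ∞`), `leiZhangZhao2017_liouville_swirl_decay` (ibid.,
  Remark 1.4: `Γ → 0` as `r → ∞` uniformly), `leiRenZhang2019_liouville_swirl_rate` (Lei–Ren–Zhang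
  arXiv:1902.11229, Thm 1.2: the rate condition `|Γ² − L²| ≤ ε₀L²/r`) and
  `leiRenZhang2019_swirl_sup_at_infinity` (ibid., §4: `lim sup_{r→∞} sup_{z,t} |Γ| = sup |Γ|`,
  rendered through positive-measure superlevel sets), with the proved sanity implications
  `….knss_axisymmetric_no_swirl` (each Liouville piece contains Thm 5.2) and
  `AxisymmetricLiouvilleBoundedSwirl.…` ((AX-L) contains each piece).

## Conjecture/notion split (coordinator 2026-08-15)

The four open statements of this file — `LiouvilleConjectureNS` (ns.S22), `TypeIDSSLiouvilleConjecture`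
(ns.S26), `AxisymmetricSwirlRegularity` and `AxisymmetricLiouvilleBoundedSwirl` (ns.S25) — are
canonical at `Summit.NavierStokesRegularity.NavierStokesRegularity.<Name>`, the conjecture leaves
`Summits/NavierStokesRegularity/NavierStokesRegularity/Theorems/<Name>.lean` (same definientia; the
`TypeIDSSLiouvilleConjecture` leaf imports this module for `TypeIDSSLiouville` /
`RotatedTypeIDSSLiouville`); the four `@[conjecture] def`s below are transitional duplicates, and
no declaration of this file mentions them any more. The theorems relating the conjectures to each
other and to the `ℝ³`-valued no-swirl theorem — `LiouvilleConjectureNS.axisymmetric_no_swirl`,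
`LiouvilleConjectureNS.axisymmetricLiouvilleBoundedSwirl`, `AxisymmetricLiouvilleBoundedSwirl.of_hasNoSwirl`,
`typeIDSSLiouvilleConjecture_iff` — live in `SelfSimilarLiouvilleConsequences.lean`, which imports
the leaves and states them for the canonical conjectures. The seven sanity implications whose last
name component is a named fact of this file (`LiouvilleConjectureNS.knss2009_axisymmetric_no_swirl'`,
`….leiRenZhang2019_liouville_swirl_rate`, `….leiZhangZhao2017_liouville_swirl_decay`,
`AxisymmetricLiouvilleBoundedSwirl.knss2009_axisymmetric_no_swirl'`, `….leiRenZhang2019_liouville_swirl_rate`,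
`….leiZhangZhao2017_liouville_swirl_decay`, `….leiRenZhang2019_swirl_sup_at_infinity`) stay here
under their names — the gate's removal lint pins them, the fact names being used by the discharge
files — and take the statement (L), resp. (AX-L), written out as their hypothesis, so that they
apply verbatim to a witness of the canonical conjecture.

## Mathlib / H21 search

Mathlib (this pin) has no Navier–Stokes, self-similar profile, ancient solution, Liouville-for-NS
or axisymmetry notions (searched `selfSimilar`, `Liouville` in `Analysis/` — only the complex
analysis Liouville theorem `Differentiable.apply_eq_apply_of_bounded` —, `ancient`,
`NavierStokes`, `xisymm`: nothing relevant). Used from Mathlib: `MeasureTheory.MemLp`,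
`MeasureTheory.LocallyIntegrable`, `AEStronglyMeasurable`, `Filter.EventuallyEq` (`=ᵐ[volume]`),
`Metric.ball`, `fderiv`, `ContDiff`, `LinearIsometryEquiv`, `Set.Ioo/Ioi/Ici`. Everything
else is the accepted H21 vocabulary listed above; nothing is (re)defined here except the five
`Prop`-valued problem statements.

## Design choices

* **Measurability class.** The accepted duality-form mild predicates
  (`Fluid.IsMildNSSolutionBetween`, `Fluid.IsWeaklyDivFree`) are Bochner integrals with junk
  value `0` and are meaningful only together with an integrability class, which
  `Fluid.IsAncientMildSolution` does not contain, while `Fluid.IsBoundedOn`, `Fluid.HasTypeIDecay`,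
  `Fluid.IsAxisymmetric` and DSS are pointwise. Without measurability, a bounded field supported
  on a nowhere-measurable (Bernstein) set satisfies every hypothesis vacuously. Every Liouville
  statement (ns.S22, S25 (AX-L), S26) therefore carries the `L^∞`/`L^∞_loc` class of KNSS 2009,
  §1 as the explicit slice-wise hypothesis `∀ t < 0, AEStronglyMeasurable (u t) volume`; together
  with the pointwise bounds this makes every slice a genuine `L^∞_loc` field and the pairings in
  the mild identity honest integrals.
* **A.e., slice-wise conclusions.** Mild (duality-form) solutions only determine each slice
  `u t` almost everywhere in `x`, so a pointwise conclusion "`u t x = b` for all `x`" would be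
  false for trivial reasons (modify a constant on a null set); conclusions are stated slice-wise
  almost everywhere. Moreover the duality identity is tested against compactly supported
  divergence-free fields, which have zero mean, so it does *not see* a time-dependent spatial
  constant `b(t)`: exactly as for `Fluid.isBoundedAncientMildSolution_const`, every bounded
  `u(t, x) = b(t)` is a bounded ancient mild solution of the accepted class. This is precisely why
  KNSS 2009, Thm 5.2 concludes `u(x, t) = (0, 0, b(t))` (the mild normalisation pinning `b` is
  not part of the duality-form class). "Constant" is hence rendered as *spatially constant on
  every slice*, `∀ t < 0, ∃ b, u t =ᵐ[volume] fun _ => b` (KNSS 2009, §5, Thm 5.2); vanishing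
  conclusions (`knss_bound_C_over_r`, ns.S26) are `∀ t < 0, u t =ᵐ[volume] 0`. By KNSS 2009, §2–3,
  bounded ancient mild solutions have a smooth representative, for which this is constancy in
  `x`. Hypotheses (axisymmetry, swirl and Type I bounds) are pointwise, as in print, and only
  restricted to `t < 0` (the slices `u t`, `t ≥ 0`, of an ancient solution are junk and
  unconstrained).
* **Viscosity.** ns.S22, S25 (AX-L), S26 are stated with `ν = 1` as in KNSS 2009 and
  Seregin–Šverák 2009 (the general case `ν > 0` reduces to it by the change of variables
  `u(t, x) ↦ ν⁻¹ u(ν⁻¹ t, x)`, which maps `(−∞, 0)` onto itself); ns.S21 and S25 (AX) keep `ν > 0` explicit like Clay (A).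
* **ns.S21.** The profile class is the accepted pointwise `C²` system `Fluid.IsLerayProfile ν a`
  (NRŠ and Tsai state the Leray system for weak `L³`/`L^q` profiles, which are smooth by
  elliptic regularity, NRŠ 1996, §2 — recorded in `SelfSimilar`). Tsai's Theorem 2 asks that the
  self-similar solution satisfy the *local energy estimates*
  `ess sup_{t₀<t<T} ∫_{B₁} |u|² + ∫_{t₀}^{T} ∫_{B₁} |∇u|² < ∞` near the singular point `(0, T)`; since
  `u t = lerayBackward a T U t` is `C²` for `t < T`, `∇u` is the classical `fderiv` and the two
  estimates are written with lower Lebesgue integrals over `Metric.ball 0 1` (no Bochner junk).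
  Tsai's `ess sup` in `t` is replaced by a pointwise `∀ t ∈ Ioo t₀ T` bound, equivalent here
  because `t ↦ ∫_{B₁} |u(t)|²` is continuous for `t < T` (`u` is jointly continuous there); and
  the unit ball `B₁(0)` suffices (equivalent to every ball `B_ρ(0)` by self-similarity of `u`,
  which maps the estimates on `B_ρ × (t₀', T)` to those on `B₁ × (t₀, T)`).
* **ns.S22, `|u| ≤ C/r`.** Written junk-free as `cylRadius x * ‖u t x‖ ≤ C` (no division;
  vacuous on the axis, as in print), exactly like the accepted `NS.knss_no_axisymmetric_typeI`.
* **ns.S26, DSS on all of `ℝ × ℝ³`.** `Fluid.IsDiscretelySelfSimilar λ u` (`nsRescale λ u = u`)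
  and `Fluid.IsRotatedDSS` constrain `u` for all times, including the junk slices `t ≥ 0` of an
  ancient solution. Inside a universally quantified Liouville statement this costs nothing:
  given `u` that is DSS for `t < 0` only, apply the statement to the field equal to `u` for
  `t < 0` and `0` for `t ≥ 0`, which is DSS everywhere and has the same ancient-mild, Type I and
  conclusion clauses (all of which only see `t < 0`). In `RotatedTypeIDSSLiouville λ R` the map
  `R` ranges over the whole orthogonal group `O(3)` (any `ℝ³ ≃ₗᵢ[ℝ] ℝ³`), a superset of
  the rotations `R(φ)` about the `x₃`-axis of Bradshaw–Tsai's *rotated discretely self-similar*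
  (RDSS, factor `λ`, phase `φ`) fields (arXiv:1610.05680, §1); for a `Prop` parametrised by `R`
  this is harmless (the wall `TypeIDSSLiouvilleConjecture` quantifies over all of them: the RDSS
  cases — every rotation is conjugate in `SO(3)` to some `R(φ)`, and the ancient mild, Type I and
  vanishing clauses are invariant under conjugating `u` by a rotation — together with the
  improper isometries, a mild strengthening of the wall recorded here).
* **Forward DSS existence (ns.S26, existence side); corrected attributions.** The datum class
  is `u₀ ∈ L²_loc(ℝ³)` (`AEStronglyMeasurable u₀` and `LocallyIntegrable ‖u₀‖²`), weakly
  divergence free and `λ`-DSS (`nsRescaleData λ u₀ = u₀`, i.e. `λ u₀(λx) = u₀(x)`), `λ > 1`.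
  Two theorems in print construct global `λ`-DSS solutions for such data, in *different*
  classes. (i) Chae–Wolf (arXiv:1610.01386 = Ann. Inst. H. Poincaré C 35 (2018), Thm 1.4 with
  Def. 1.2): a *local Leray solution with projected pressure* — `u ∈ L^∞(0,T; L²(G)) ∩
  L²(0,T; W^{1,2}(G))`, weakly continuous into `L²(G)`, for every bounded `G` and `T`, a
  distributional solution against divergence-free tests, `u(t) → u₀` in `L²(G)`, and a local
  energy inequality *with projected pressure* ((1.11): `v_G = u + ∇p_{h,G}` with the Stokes
  pressure projection `E*_G`); no global pressure and *not* the Caffarelli–Kohn–Nirenberg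
  inequality (Bradshaw–Tsai arXiv:1801.08060, §1: "not shown to satisfy the local energy
  inequality of [CKN]"). (ii) Bradshaw–Tsai (arXiv:1801.08060 = Analysis & PDE 12 (2019),
  Thm 1.2): a `λ`-DSS distributional solution `v` with a pressure `π ∈ L^{3/2}_loc`, *suitable in
  the sense of CKN* on `ℝ³ × (0, ∞)`, `v ∈ L^∞(0,T; L²(K)) ∩ L²(0,T; H¹(K))`,
  `π ∈ L^{3/2}((0,T) × K)` and `‖v(t) − v₀‖_{L²(K)} → 0` for all compact `K` and `T > 0` (plus an
  explicit pressure formula, omitted here). The historical declaration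
  `chae_wolf_dss_existence` (name kept: it is referenced by route files) renders (ii), not (i):
  a global weak solution with datum `u₀` (`Fluid.IsWeakNSSolutionOn T 1 0 u₀ u` for every
  `T > 0`; this pressure-free form with datum follows from the distributional identity, the
  local energy class and the `L²_loc` attainment of the datum by a cut-off in time) admitting a
  pressure `p` with which it is a suitable weak solution on the open slab `(0, ∞) × ℝ³`
  (`Fluid.IsSuitableWeakSolutionOn`, CKN local energy inequality), `λ`-DSS on all of `ℝ × ℝ³`.
  Its interim docstring attributed it to "Chae–Wolf, Thm 1.2, arXiv:1610.09464, `(α, λ)`-DSS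
  data": that arXiv number is Chae–Wolf's *Removing discretely self-similar singularities*
  (Comm. PDE 42 (2017); backward DSS, no existence theorem), Chae–Wolf's existence theorem is
  Thm 1.4 of arXiv:1610.01386 and concerns class (i), and rotated ("`(α, λ)`") DSS data are
  Bradshaw–Tsai's (arXiv:1610.05680, Thm 1.3, `L³_w` data), not Chae–Wolf's. The corrected
  picture: `bradshawTsai2019_dss_existence` renders (ii) with its energy/pressure classes up
  to `t = 0` and the attainment of the datum, and implies `chae_wolf_dss_existence`
  (projection); `chaeWolf2018_dss_existence` renders (i) minus the projected-pressure
  inequality and the weak continuity (the prelude has no Stokes projection `E*_G`; a weakening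
  of the conclusion of an existence theorem, hence still a theorem in print) and is likewise
  implied by `bradshawTsai2019_dss_existence` (Bradshaw–Tsai call their theorem "a slight
  refinement of the main result of [Chae–Wolf]", arXiv:1801.08060, Comments on Thm 1.2).
  Renderings: energy classes as `∀ᵐ t ∈ (0,T)` bounds on `∫_K ‖u(t)‖²` and `L²((0,T) × K)`
  bounds on a weak spatial gradient `G` (`Fluid.HasWeakSpatialGradientOn` on the open slab);
  the datum is attained as `∫_K ‖u(t) − u₀‖² → 0` for `t → 0⁺`; the solution is `λ`-DSS on all
  of `ℝ × ℝ³` (`Fluid.IsDiscretelySelfSimilar`, an identity at every `(t, x)`: in print the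
  solution is obtained on `B₁ × (0, T)` and then *extended by discrete self-similarity* to
  `ℝ³ × (0, ∞)` — Bradshaw–Tsai arXiv:1801.08060, §4.2 (extendability) and the proof of Thm 1.2
  in §4.3 —, so that `λ v(λ²t, λx) = v(t, x)` may be taken to hold identically for `t > 0`
  (choose the representative on the fundamental domain `[1, λ²) × ℝ³` of the scaling and
  extend); extend by `0` for `t ≤ 0` — the weak formulation reads the datum from `u₀`, not from
  `u 0`, and no solution clause sees `t ≤ 0`).
* **ns.S25 (AX).** Hypotheses on the datum are exactly those of Clay (A) / the accepted ns.S24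
  (`ContDiff ℝ ∞ u₀`, `Fluid.IsDivFree u₀`, `NS.HasRapidSpatialDecay u₀`) plus axisymmetry (swirl
  allowed); the conclusion is a global classical solution `Fluid.IsClassicalNSSolutionOn (Ici 0)`
  (which contains joint smoothness of `u` and `p` on `[0, ∞) × ℝ³`) with `u 0 = u₀` and bounded
  energy `NS.HasBoundedEnergy u` (Fefferman's (7), excluding the parasitic solutions), verbatim
  the shape of `NS.axisymmetric_no_swirl_global_regularity` minus the no-swirl clauses.
* Theorem numbers (verified against arXiv:0709.3599, §5, and Tsai 1998 / NRŠ 1996 as held):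
  KNSS 2009, Thm 5.1 is the two-dimensional Liouville theorem, Thm 5.2 the axisymmetric
  no-swirl case (`u(x,t) = (0, 0, b₃(t))`), Thm 5.3 the case `|u| ≤ C/√(x₁² + x₂²)` (`u = 0`), all
  for *bounded weak* solutions on `ℝ³ × (−∞, 0)`; NRŠ 1996, Thm 1 (p. 291) is the `L³` profile
  theorem; Tsai 1998, Thm 1 is the `L^q` profile theorem (`3 < q ≤ ∞`: constant, hence zero for
  `q < ∞`) and Thm 2 the local-energy theorem (estimates (1.4) on the cylinder
  `Q₁(0, T) = B₁(0) × (T − 1, T)`). (The interim text had Tsai's two numbers interchanged.)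

## References

* J. Nečas, M. Růžička, V. Šverák, *On Leray's self-similar solutions of the Navier–Stokes
  equations*, Acta Math. 176 (1996) 283–294, Theorem 1 (p. 291) [NecasRuzickaSverak1996].
* T.-P. Tsai, *On Leray's self-similar solutions of the Navier–Stokes equations satisfying local
  energy estimates*, Arch. Rational Mech. Anal. 143 (1998) 29–51, Theorems 1–2 [Tsai1998].
* G. Seregin, V. Šverák, *On Type I singularities of the local axi-symmetric solutions of the
  Navier–Stokes equations*, Comm. PDE 34 (2009), §1, conjecture (L) [SereginSverak2009].
* G. Koch, N. Nadirashvili, G. Seregin, V. Šverák, *Liouville theorems for the Navier–Stokes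
  equations and applications*, Acta Math. 203 (2009) 83–105 = arXiv:0709.3599, Theorems
  5.1–5.3, §5 [KochNadirashviliSereginSverak2009].
* Z. Lei, X. Ren, Q. S. Zhang, *On ancient periodic solutions to axially-symmetric Navier–Stokes
  equations*, arXiv:1902.11229 (2019), §1, Theorems 1.1–1.2 (p. 4), §4 (pp. 10–12: proof of
  Theorem 1.2; p. 10: `lim sup_{r→∞} |Γ| = sup |Γ|`) (published split: *A Liouville
  theorem for axi-symmetric Navier–Stokes equations on `ℝ² × 𝕋¹`*, Math. Ann. 383 (2022)
  415–431, and *Liouville type theorems for axially symmetric Navier–Stokes equations*, Sci.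
  Sin. Math. 51 (2021) 971–984) [LeiRenZhang2019].
* Z. Lei, Q. S. Zhang, N. Zhao, *Improved Liouville theorems for axially symmetric Navier–Stokes
  equations*, arXiv:1701.00868 = Sci. Sin. Math. 47 (2017), doi:10.1360/N012016-00149, Theorem
  1.3 and Remark 1.4 (arXiv p. 4), §5 Lemmas 5.1–5.2 (pp. 10–12) [LeiZhangZhao2017].
* Q. S. Zhang, with an addendum by X. Pan and Q. S. Zhang, *A review of results on axially
  symmetric Navier–Stokes equations*, Anal. Theory Appl. 38 (2022) 243–296 = arXiv:2101.04905,
  §3 (ancient solutions; Theorems 3.2–3.7 and the discussion on p. 12) [ZhangPan2022].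
* D. Chae, J. Wolf, *Existence of discretely self-similar solutions to the Navier–Stokes
  equations for initial value in `L²_loc(ℝ³)`*, arXiv:1610.01386 (v1, 2016), Ann. Inst. H.
  Poincaré C Anal. Non Linéaire 35 (2018) 1019–1039, Definition 1.2 and Theorem 1.4 (arXiv
  numbering) [ChaeWolf2018].
* D. Chae, J. Wolf, *Removing discretely self-similar singularities for the 3D Navier–Stokes
  equations*, arXiv:1610.09464, Comm. PDE 42 (2017) 1359–1374, Theorems 1.1 and 1.3
  [ChaeWolf2017RemovingDSS] (the interim stub key `arXiv161009464` names the same paper).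
* Z. Bradshaw, T.-P. Tsai, *Discretely self-similar solutions to the Navier–Stokes equations
  with data in `L²_loc` satisfying the local energy inequality*, arXiv:1801.08060, Analysis &
  PDE 12 (2019) 1943–1962, Definition 1.1 and Theorem 1.2 [BradshawTsai2019].
* Z. Bradshaw, T.-P. Tsai, *Forward discretely self-similar solutions of the Navier–Stokes
  equations II*, arXiv:1510.07504, Ann. Henri Poincaré 18 (2017) 1095–1119 [BradshawTsai2017AHP].
* Z. Bradshaw, T.-P. Tsai, *Rotationally corrected scaling invariant solutions to the
  Navier–Stokes equations*, arXiv:1610.05680, Comm. PDE 42 (2017) 1065–1087, §1 (RSS/RDSS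
  fields), Theorem 1.3, and §5, Open Problem 5.1 (the backward Type I RSS/DSS/RDSS problem)
  [BradshawTsai2017CPDE].
* T.-P. Tsai, *Lectures on Navier–Stokes equations*, GSM 192 (AMS 2018), Conjectures 8.8–8.9.
* Gap inventory `families/ns.json` (ns.S21, S22, S25, S26); walls
  `summits/ns-w-axisym-swirl/SUMMIT.md`, `summits/ns-w-typeI-dss-liouville`.
-/

noncomputable section

open MeasureTheory Set Function Filter Topology TopologicalSpace
open scoped ContDiff NNReal ENNReal InnerProductSpace RealInnerProductSpace

namespace Literature.Analysis.FluidPDE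

/-- Local notation for physical space `ℝ³ = EuclideanSpace ℝ (Fin 3)`. -/
local notation "ℝ³" => EuclideanSpace ℝ (Fin 3)

/-! ## ns.S21: no backward self-similar blow-up -/

/-- **ns.S21** (no backward self-similar blow-up in `L³`; Nečas–Růžička–Šverák, Acta Math. 176
(1996), Theorem 1). Let `ν > 0`, `a > 0`, and let `(U, P)` solve Leray's profile system
`−νΔU + aU + a(y·∇)U + (U·∇)U + ∇P = 0`, `div U = 0` on `ℝ³` (so that
`u(t, x) = (2a(T−t))^{-1/2} U(x/√(2a(T−t)))` is a self-similar solution of Navier–Stokes blowing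
up at time `T`, `Fluid.lerayBackward_isClassical_iff`). If `U ∈ L³(ℝ³)` then `U ≡ 0`. (In
print `U ∈ W^{1,2}_loc` is a weak solution of the profile system tested against divergence-free
fields — automatically smooth, p. 287, with the pressure `P = R_j R_k (U_j U_k)` of their
Lemma 3.1 —; a `C²` pair `(U, P)` solving the system pointwise (`Fluid.IsLerayProfile`) is such
a weak solution, whatever `P`.) [cite: NecasRuzickaSverak1996, Thm 1 (p. 291)] -/
def necas_ruzicka_sverak : Prop :=
  ∀ {ν a : ℝ} (hν : 0 < ν) (ha : 0 < a) {U : ℝ³ → ℝ³} {P : ℝ³ → ℝ} (hprof : FluidPDE.IsLerayProfile ν a U P) (hU : MemLp U 3),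
    U = 0

/-- **ns.S21** (no backward self-similar blow-up in `L^q`, `3 < q < ∞`; Tsai, Arch. Rational
Mech. Anal. 143 (1998), Theorem 1: "If a weak solution `U` of (1.3) belongs to `L^q(ℝ³)` for
some `q ∈ (3, ∞]`, then it must be constant (and hence identically zero if `q < ∞`)"). Let
`ν > 0`, `a > 0`, and let `(U, P)` solve Leray's profile system on `ℝ³`. If `U ∈ L^q(ℝ³)` for
some `3 < q < ∞` then `U ≡ 0`. (Constants are the only bounded candidates and are excluded by
`q < ∞`; the case `q = 3` is `necas_ruzicka_sverak`; the `C²` profile class is contained in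
Tsai's weak class.) [cite: Tsai1998, Thm 1] -/
def tsai_selfsimilar : Prop :=
  ∀ {ν a : ℝ} (hν : 0 < ν) (ha : 0 < a) {U : ℝ³ → ℝ³} {P : ℝ³ → ℝ} (hprof : FluidPDE.IsLerayProfile ν a U P) {q : ℝ≥0∞} (hq : 3 < q) (hq' : q < (⊤ : ℝ≥0∞)) (hU : MemLp U q),
    U = 0

/-- **ns.S21** (no backward self-similar blow-up under local energy estimates; Tsai, Arch.
Rational Mech. Anal. 143 (1998), Theorem 2: a weak solution `u` of Navier–Stokes of the
self-similar form (1.2)₁ satisfying the local energy estimates (1.4) in the cylinder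
`Q₁(0, T) = B₁(0) × (T − 1, T)` vanishes). Let `ν > 0`, `a > 0`, `t₀ < T`, and let `(U, P)`
solve Leray's profile system on `ℝ³`, so that `u = Fluid.lerayBackward a T U` is a (smooth for
`t < T`) self-similar solution of Navier–Stokes on `(-∞, T) × ℝ³` with putative singularity at
`(0, T)`. If `u` satisfies the *local energy estimates* near the singularity,
`sup_{t₀ < t < T} ∫_{B₁(0)} |u(t, x)|² dx < ∞` and `∫_{t₀}^{T} ∫_{B₁(0)} |∇u(t, x)|² dx dt < ∞`
(as every Leray–Hopf weak solution does), then `U ≡ 0`. The gradient is the classical `fderiv`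
of the `C²` slices, measured by the Frobenius norm `Fluid.frobeniusNormSq`. (For `t₀ ≤ T − 1`
the hypothesis contains Tsai's; for `T − 1 < t₀ < T` self-similarity transports the estimates
from `B₁ × (t₀, T)` to `B₁ × (T − 1, T)`, module docstring "ns.S21".) [cite: Tsai1998, Thm 2] -/
def tsai_selfsimilar_local_energy : Prop :=
  ∀ {ν a T t₀ : ℝ} (hν : 0 < ν) (ha : 0 < a) (ht₀ : t₀ < T) {U : ℝ³ → ℝ³} {P : ℝ³ → ℝ} (hprof : FluidPDE.IsLerayProfile ν a U P) (henergy : ∃ C : ℝ≥0, ∀ t ∈ Ioo t₀ T, ∫⁻ x in Metric.ball (0 : ℝ³) 1, ‖FluidPDE.lerayBackward a T U t x‖ₑ ^ 2 ≤ C) (hgrad : ∫⁻ t in Ioo t₀ T, ∫⁻ x in Metric.ball (0 : ℝ³) 1, ENNReal.ofReal (FluidPDE.frobeniusNormSq (fderiv ℝ (FluidPDE.lerayBackward a T U t) x)) < (⊤ : ℝ≥0∞)),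
    U = 0

/-! ## ns.S22: the Liouville conjecture for bounded ancient mild solutions -/

/-- **ns.S22** (the Liouville conjecture (L) for Navier–Stokes; Seregin–Šverák, Comm. PDE 34
(2009), §1; Koch–Nadirashvili–Seregin–Šverák, Acta Math. 203 (2009), §1). Every bounded ancient
mild solution `u ∈ L^∞(ℝ³ × (−∞, 0))` (measurable slices, `AEStronglyMeasurable (u t)`, and
`Fluid.IsBoundedOn`) of the Navier–Stokes equations (`ν = 1`, `f = 0`) is constant: for every
`t < 0` there is `b ∈ ℝ³` with `u(t, ·) = b` a.e. ("constant" is rendered as *spatially constant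
on every slice*, since the duality-form mild class does not see a time-dependent constant `b(t)`,
and a.e. because it determines the slices only almost everywhere; KNSS 2009, §5, Thm 5.2 and the
module docstring). **Open**; it would exclude Type I blow-up. Stated as a `Prop` only. **Transitional
duplicate.** Since the conjecture/notion split of 2026-08-15 the CANONICAL statement of this open
conjecture is `Summit.NavierStokesRegularity.NavierStokesRegularity.LiouvilleConjectureNS` (leaf file
`Summits/NavierStokesRegularity/NavierStokesRegularity/Theorems/LiouvilleConjectureNS.lean`, same
definiens); no declaration of this file mentions this copy any more (the consequences of (L) either
moved to `SelfSimilarLiouvilleConsequences.lean` or take the statement written out as their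
hypothesis, see `LiouvilleConjectureNS.knss2009_axisymmetric_no_swirl'`); it is kept only while
other modules (`TypeIAncientLiouville.lean`, `LocalTypeILiouville.lean`, …) and route records still
name it; new developments must use the canonical name. [cite: KochNadirashviliSereginSverak2009, §1] -/
@[conjecture] def LiouvilleConjectureNS : Prop :=
  ∀ u : ℝ → ℝ³ → ℝ³, FluidPDE.IsBoundedAncientMildSolution 1 u →
    (∀ t < 0, AEStronglyMeasurable (u t) volume) →
      ∀ t < 0, ∃ b : ℝ³, u t =ᵐ[volume] fun _ => b

/-- **ns.S22** (Liouville theorem for axisymmetric ancient solutions without swirl;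
Koch–Nadirashvili–Seregin–Šverák, Acta Math. 203 (2009) = arXiv:0709.3599, Theorem 5.2: "Let
`u` be a bounded weak solution of the Navier–Stokes equations in `ℝ³ × (−∞, 0)`. Assume that `u`
is axi-symmetric with no swirl. Then `u(x,t) = (0, 0, b₃(t))` for some bounded measurable
`b₃`"). Let `u ∈ L^∞(ℝ³ × (−∞, 0))` (measurable slices) be a bounded ancient
mild solution of Navier–Stokes (`ν = 1`) which is axisymmetric with no swirl (`u_θ ≡ 0`) at
every `t < 0`. Then `u(x, t) = (0, 0, b(t))`: every slice is a.e. equal to a constant multiple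
`β • e_z` of the axial unit vector `Fluid.eZ` (KNSS's conclusion verbatim; the time dependence
of `b(t)` is genuine in the duality-form class, module docstring). **Class.** This rendering
asks only for measurable *slices*, formally weaker than print's `u ∈ L^∞(ℝ³ × (−∞, 0))` (joint
measurability): the duality-form class even contains every family of spatial constants
`u(t, x) = b(t)` with `b` non-measurable (`isBoundedAncientMildSolution_timeConst`,
`AncientMildDrift`). The statement is nevertheless a consequence of the theorem **as printed**
(`KNSS2009_liouville_axisymmetric_no_swirl`, `KNSSLiouville`): `knss_axisymmetric_no_swirl_of_KNSS2009`
(`KNSSThm52SliceBridge`, proved) reduces the slice-wise class to the printed one modulo a possibly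
non-measurable axial drift `c(t) e_z`, which is invisible to the solenoidal tests and is removed by
the drift lemma of `AncientMildDrift`; hence it follows from KNSS's §4 regularity fact alone
(`knss_axisymmetric_no_swirl_of_prop41_mild`). The print-faithful rendering carrying the joint
measurability hypothesis is `knss2009_axisymmetric_no_swirl` below, which this one trivially implies
(`knss_axisymmetric_no_swirl.knss2009`) and which is also derived from KNSS's §4 regularity and
Lemma 2.1 (named facts) in `KNSSThm52Assembly` (`knss2009_axisymmetric_no_swirl_of_facts`) and in
`KNSSThm52OfProp41`. [cite: KochNadirashviliSereginSverak2009, Thm 5.2] -/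
def knss_axisymmetric_no_swirl : Prop :=
  ∀ {u : ℝ → ℝ³ → ℝ³} (hu : FluidPDE.IsBoundedAncientMildSolution 1 u) (hmeas : ∀ t < 0, AEStronglyMeasurable (u t) volume) (haxi : ∀ t < 0, FluidPDE.IsAxisymmetric (u t)) (hswirl : ∀ t < 0, FluidPDE.HasNoSwirl (u t)),
    ∀ t < 0, ∃ β : ℝ, u t =ᵐ[volume] fun _ => β • FluidPDE.eZ

/-- **ns.S22** (Liouville theorem under the bound `|u| ≤ C/r`; Koch–Nadirashvili–Seregin–Šverák,
Acta Math. 203 (2009) = arXiv:0709.3599, Theorem 5.3: "Let `u` be a bounded weak solution of the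
Navier–Stokes equations in `ℝ³ × (−∞, 0)`. Assume that `u` is axi-symmetric and, in addition,
satisfies `|u(x,t)| ≤ C/√(x₁² + x₂²)`. Then `u = 0`"). Let
`u ∈ L^∞(ℝ³ × (−∞, 0))` (measurable slices) be a bounded ancient mild solution of Navier–Stokes
(`ν = 1`), axisymmetric at every `t < 0`, with `|u(t, x)| ≤ C / √(x₀² + x₁²)` on
`(−∞, 0) × ℝ³` (written junk-free as `r ‖u(t, x)‖ ≤ C`, vacuous on the axis as in print). Then
`u ≡ 0` (a.e. on every slice `t < 0`). [cite: KochNadirashviliSereginSverak2009, Thm 5.3] -/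
def knss_bound_C_over_r : Prop :=
  ∀ {u : ℝ → ℝ³ → ℝ³} (hu : FluidPDE.IsBoundedAncientMildSolution 1 u) (hmeas : ∀ t < 0, AEStronglyMeasurable (u t) volume) (haxi : ∀ t < 0, FluidPDE.IsAxisymmetric (u t)) (hbound : ∃ C : ℝ, ∀ t < 0, ∀ x, FluidPDE.cylRadius x * ‖u t x‖ ≤ C),
    ∀ t < 0, u t =ᵐ[volume] 0

-- `LiouvilleConjectureNS.axisymmetric_no_swirl` ((L) contains the `ℝ³`-valued no-swirl theorem)
-- MOVED (conjecture/notion split, 2026-08-15) to `SelfSimilarLiouvilleConsequences.lean`, stated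
-- for the canonical `Summit.NavierStokesRegularity.NavierStokesRegularity.LiouvilleConjectureNS`.

/-! ## ns.S26: Type I discretely self-similar Liouville problem; forward DSS existence -/

/-- **ns.S26** (Type I `λ`-DSS Liouville problem, wall `summits/ns-w-typeI-dss-liouville`;
Bradshaw–Tsai, *Rotationally corrected scaling invariant solutions*, arXiv:1610.05680 = Comm.
PDE 42 (2017), §5, **Open Problem 5.1**: "Suppose `v(x,t)` is a backward RSS/DSS/RDSS solution of
(NSE) in `ℝ³` with `|v(x,t)| ≤ C/(|x| + √(−t))` in `ℝ³ × (−1, 0)`, does `v` remain bounded up to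
time `0`?" — for a (rotated) `λ`-DSS field boundedness near `(0, 0)` forces `v ≡ 0` by iterating
`v(x,t) = λ^k R^{-k} v(λ^k R^k x, λ^{2k} t)`, `k → −∞`, so the problem is the vanishing statement
below; Tsai, *Lectures on Navier–Stokes equations*, GSM 192 (2018), Conjectures 8.8–8.9; partial
results: Chae–Wolf, *Removing discretely self-similar singularities*, arXiv:1610.09464, Thm 1.1
(backward `λ`-DSS solutions in `C((−∞,0); L^p) ∩ C^∞`, `3 ≤ p < ∞`, are regular off the origin
with `|u| ≤ C/(√(−t) + |x|)`) and Thm 1.3 (for every `C_*` there is `λ_*(C_*) > 1` such that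
smooth `λ`-DSS solutions with this bound vanish when `1 < λ < λ_*`);
`chaeWolf2018_dss_existence` and `bradshawTsai2019_dss_existence` below for the forward
existence side). For the
scaling factor `λ > 1`: every ancient mild solution `u` of Navier–Stokes (`ν = 1`) on
`ℝ³ × (−∞, 0)` with measurable slices (`AEStronglyMeasurable (u t)`, `t < 0`; with the Type I
bound this is the class `L^∞_loc`) which is `λ`-discretely self-similar,
`λ u(λ²t, λx) = u(t, x)`, and obeys a Type I bound `|u(t, x)| ≤ C₀ / (|x| + √(−t))` for some
`C₀`, vanishes (a.e. on every slice `t < 0`). **Open** (flag); `def` only.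
`Fluid.IsDiscretelySelfSimilar` constrains `u` at all times; see the module docstring for why
this is harmless. For `λ ≤ 1` the statement is vacuous (`1 < λ →`). [cite: BradshawTsai2017CPDE, §5 Open Problem 5.1] -/
def TypeIDSSLiouville (c : ℝ) : Prop :=
  1 < c → ∀ u : ℝ → ℝ³ → ℝ³, FluidPDE.IsAncientMildSolution 1 u →
    (∀ t < 0, AEStronglyMeasurable (u t) volume) →
      FluidPDE.IsDiscretelySelfSimilar c u → (∃ C₀ : ℝ, FluidPDE.HasTypeIDecay C₀ u) →
        ∀ t < 0, u t =ᵐ[volume] 0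

/-- **ns.S26** (Type I rotated `λ`-DSS Liouville problem, wall
`summits/ns-w-typeI-dss-liouville`; Bradshaw–Tsai, arXiv:1610.05680 = Comm. PDE 42 (2017), §5,
**Open Problem 5.1** (backward RSS/DSS/RDSS solutions with `|v| ≤ C/(|x| + √(−t))`: bounded up to
`t = 0`? — equivalently, for RDSS fields, `v ≡ 0`, see `TypeIDSSLiouville`); Tsai GSM 192,
Conjectures 8.8–8.9; rotated discretely self-similar fields: Bradshaw–Tsai, arXiv:1610.05680, §1
(RDSS with factor `λ` and phase `φ`, `v(x,t) = λ R(−φ) v(λ R(φ) x, λ²t)`) and Thm 1.3 (forward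
existence for `L³_w` data); backward `λ`-DSS solutions with the Type I bound: Chae–Wolf
arXiv:1610.09464, Thms 1.1 and 1.3). For
`λ > 1` and a linear isometry `R` of `ℝ³` — here *any* element of `O(3)` (`ℝ³ ≃ₗᵢ[ℝ] ℝ³`), a
superset of Bradshaw–Tsai's rotations `R(φ)` about the `x₃`-axis, see the module docstring —:
every ancient mild solution `u`
(`ν = 1`) on `ℝ³ × (−∞, 0)` with measurable slices which is rotated `λ`-DSS,
`λ Rᵀ u(λ²t, λRx) = u(t, x)`, with a Type I bound `|u| ≤ C₀/(|x| + √(−t))`, vanishes (a.e. on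
every slice `t < 0`). **Open** (flag); `def` only. For `R = 1` this is `TypeIDSSLiouville λ`
(`rotatedTypeIDSSLiouville_refl_iff`). [cite: BradshawTsai2017CPDE, §5 Open Problem 5.1] -/
def RotatedTypeIDSSLiouville (c : ℝ) (R : ℝ³ ≃ₗᵢ[ℝ] ℝ³) : Prop :=
  1 < c → ∀ u : ℝ → ℝ³ → ℝ³, FluidPDE.IsAncientMildSolution 1 u →
    (∀ t < 0, AEStronglyMeasurable (u t) volume) →
      FluidPDE.IsRotatedDSS c R u → (∃ C₀ : ℝ, FluidPDE.HasTypeIDecay C₀ u) →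
        ∀ t < 0, u t =ᵐ[volume] 0

/-- With the trivial rotation the rotated problem is the plain `λ`-DSS problem (Bradshaw–Tsai
arXiv:1610.05680, §1: "when `φ ∈ 2πℤ` we recover `λ`-DSS vector fields"; accepted
`Fluid.isRotatedDSS_refl_iff`). [cite: BradshawTsai2017CPDE, §1] -/
theorem rotatedTypeIDSSLiouville_refl_iff (c : ℝ) :
    RotatedTypeIDSSLiouville c (LinearIsometryEquiv.refl ℝ ℝ³) ↔ TypeIDSSLiouville c := by
  simp only [RotatedTypeIDSSLiouville, TypeIDSSLiouville, FluidPDE.isRotatedDSS_refl_iff]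

/-- **ns.S26** (the Type I DSS Liouville wall as a single statement,
`summits/ns-w-typeI-dss-liouville`; Tsai GSM 192, Conjectures 8.8–8.9; inventory: "for every
`λ > 1`, `α`, `C₀`"): for every scaling factor `λ` (vacuous unless `λ > 1`) the plain and, for
every `R ∈ O(3)`, the rotated Type I `λ`-DSS Liouville statements hold. **Open** (flag); `def`
only. The first conjunct is the case `R = 1` of the second (`rotatedTypeIDSSLiouville_refl_iff`)
and is kept for readability. **Transitional duplicate.** Since the conjecture/notion split of
2026-08-15 the CANONICAL statement of this open conjecture is
`Summit.NavierStokesRegularity.NavierStokesRegularity.TypeIDSSLiouvilleConjecture` (leaf file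
`Summits/NavierStokesRegularity/NavierStokesRegularity/Theorems/TypeIDSSLiouvilleConjecture.lean`,
same definiens, importing this module for `TypeIDSSLiouville` / `RotatedTypeIDSSLiouville`);
consequences about the conjecture live in `SelfSimilarLiouvilleConsequences.lean` against the
canonical name. This copy is kept only while the items of route DssFarFieldSlaving
(`Theses/DssFarFieldSlaving.lean`) and `HyperbolicDSSOrbit.lean` still name it, and is to be
deleted once they are restated; new developments must use the canonical name. [folklore] -/
@[conjecture] def TypeIDSSLiouvilleConjecture : Prop :=
  ∀ c : ℝ, TypeIDSSLiouville c ∧ ∀ R : ℝ³ ≃ₗᵢ[ℝ] ℝ³, RotatedTypeIDSSLiouville c R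

-- `typeIDSSLiouvilleConjecture_iff` (the wall ↔ its rotated half) MOVED (conjecture/notion
-- split, 2026-08-15) to `Literature/Analysis/FluidPDE/SelfSimilarLiouvilleConsequences.lean`,
-- where it is stated for the canonical
-- `Summit.NavierStokesRegularity.NavierStokesRegularity.TypeIDSSLiouvilleConjecture`.

/-- **ns.S26** (existence of `λ`-discretely self-similar *suitable* weak solutions for every
scaling factor `λ > 1` and every `λ`-DSS datum in `L²_loc`; Bradshaw–Tsai, *Discretely
self-similar solutions to the Navier–Stokes equations with data in `L²_loc` satisfying the local
energy inequality*, arXiv:1801.08060 = Analysis & PDE 12 (2019) 1943–1962, Theorem 1.2 — a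
weakening of its conclusion, see `bradshawTsai2019_dss_existence` and
`chae_wolf_dss_existence_of_bradshawTsai2019`). **Historical name, corrected attribution.** The
interim docstring attributed this statement to "Chae–Wolf, arXiv:1610.09464, Thm 1.2 (case
`α = 0` of `(α, λ)`-DSS data)"; but arXiv:1610.09464 is Chae–Wolf's *Removing discretely
self-similar singularities* (Comm. PDE 42 (2017): backward DSS, no existence theorem), while
Chae–Wolf's existence theorem — arXiv:1610.01386 = Ann. Inst. H. Poincaré C 35 (2018), Thm 1.4,
rendered as `chaeWolf2018_dss_existence` below — produces a *local Leray solution with projected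
pressure*, which is **not** shown to admit a pressure satisfying the Caffarelli–Kohn–Nirenberg
local energy inequality required here (Bradshaw–Tsai 2019, §1 and Comments on Thm 1.2: their
theorem is "a slight refinement of the main result of [Chae–Wolf]"); rotated DSS data are
Bradshaw–Tsai's (arXiv:1610.05680), not Chae–Wolf's. The name is kept because route files refer
to it. **Statement.** Let `λ > 1` and let `u₀ ∈ L²_loc(ℝ³)` be weakly divergence free and
`λ`-DSS, `λ u₀(λx) = u₀(x)`. Then the Navier–Stokes equations (`ν = 1`, `f = 0`) have a global
`λ`-DSS solution with datum `u₀`: a weak solution `u` on `ℝ³ × [0, T)` for every `T > 0`,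
admitting a pressure `p` with which `(u, p)` is a suitable weak solution (CKN local energy
inequality) on `(0, ∞) × ℝ³`, and `λ u(λ²t, λx) = u(t, x)` (module docstring, "Forward DSS
existence", for the rendering). This shows that the Liouville problems `TypeIDSSLiouville`
genuinely concern *ancient* (backward) DSS solutions: forward DSS solutions abound. [cite: BradshawTsai2019, Thm 1.2] -/
def chae_wolf_dss_existence : Prop :=
  ∀ {c : ℝ} (hc : 1 < c) {u₀ : ℝ³ → ℝ³} (hmeas : AEStronglyMeasurable u₀ volume) (hL2 : LocallyIntegrable (fun x => ‖u₀ x‖ ^ 2) volume) (hdiv : FluidPDE.IsWeaklyDivFree u₀) (hdss : FluidPDE.nsRescaleData c u₀ = u₀),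
    ∃ (u : ℝ → ℝ³ → ℝ³) (p : ℝ → ℝ³ → ℝ),
      (∀ T : ℝ, 0 < T → FluidPDE.IsWeakNSSolutionOn T 1 0 u₀ u) ∧
      FluidPDE.IsSuitableWeakSolutionOn (FluidPDE.slab ℝ³ (Ioi 0) isOpen_Ioi) 1 0 u p ∧
      FluidPDE.IsDiscretelySelfSimilar c u

/-- **ns.S26** (Bradshaw–Tsai, *Discretely self-similar solutions to the Navier–Stokes equations
with data in `L²_loc` satisfying the local energy inequality*, arXiv:1801.08060 = Analysis & PDE
12 (2019) 1943–1962, **Theorem 1.2**). Assume `v₀ ∈ L²_loc(ℝ³)` is a divergence free `λ`-DSS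
vector field for some `λ > 1`. Then there exists a `λ`-DSS distributional solution `v` of the
Navier–Stokes equations (`ν = 1`, `f = 0`) on `ℝ³ × (0, ∞)` and an associated pressure `π` so
that `v` is suitable in the sense of Caffarelli–Kohn–Nirenberg and
`lim_{t → 0⁺} ‖v(t) − v₀‖_{L²(K)} = 0` for every compact `K ⊆ ℝ³`; moreover, for any `T > 0` and
compact `K`, `v ∈ L^∞(0,T; L²(K)) ∩ L²(0,T; H¹(K))` and `π ∈ L^{3/2}(0,T; L^{3/2}(K))`. (Theorem
1.2 furthermore gives the explicit pressure formula
`π = −|v|²/3 + p.v. ∫ K_{ij}(x−y) v_i v_j(y,t) dy` in `L^{3/2}_loc`, omitted here: a weakening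
of the conclusion.) Rendering (module docstring, "Forward DSS existence"): the distributional
solution with datum attained in `L²_loc` and local energy class up to `t = 0` is recorded both
as the pressure-free weak solution with datum `Fluid.IsWeakNSSolutionOn T 1 0 v₀ v` for every
`T > 0` and through its constituents — `∀ᵐ t ∈ (0,T)`-bounds on `∫_K ‖v(t)‖²`, a weak spatial
gradient `G` (`Fluid.HasWeakSpatialGradientOn` on the open slab `(0, ∞) × ℝ³`) with
`∫_{(0,T)×K} |G|² < ∞`, `∫_{(0,T)×K} |π|^{3/2} < ∞`, and `∫_K ‖v(t) − v₀‖² → 0` as `t → 0⁺` —;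
CKN suitability is `Fluid.IsSuitableWeakSolutionOn` on the open slab; `v` is `λ`-DSS on all of
`ℝ × ℝ³` (`Fluid.IsDiscretelySelfSimilar`; extension by `0` for `t ≤ 0`). [cite: BradshawTsai2019, Thm 1.2] -/
def bradshawTsai2019_dss_existence : Prop :=
  ∀ {c : ℝ}, 1 < c → ∀ {u₀ : ℝ³ → ℝ³}, AEStronglyMeasurable u₀ volume →
    LocallyIntegrable (fun x => ‖u₀ x‖ ^ 2) volume → FluidPDE.IsWeaklyDivFree u₀ →
      FluidPDE.nsRescaleData c u₀ = u₀ →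
    ∃ (u : ℝ → ℝ³ → ℝ³) (p : ℝ → ℝ³ → ℝ),
      FluidPDE.IsDiscretelySelfSimilar c u ∧
      (∀ T : ℝ, 0 < T → FluidPDE.IsWeakNSSolutionOn T 1 0 u₀ u) ∧
      FluidPDE.IsSuitableWeakSolutionOn (FluidPDE.slab ℝ³ (Ioi 0) isOpen_Ioi) 1 0 u p ∧
      (∀ K : Set ℝ³, IsCompact K →
        Tendsto (fun t => ∫⁻ x in K, ‖u t x - u₀ x‖ₑ ^ 2) (𝓝[>] 0) (𝓝 0)) ∧
      (∀ K : Set ℝ³, IsCompact K → ∀ T : ℝ, 0 < T →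
        (∃ C : ℝ≥0, ∀ᵐ t ∂(volume.restrict (Ioo 0 T)), ∫⁻ x in K, ‖u t x‖ₑ ^ 2 ≤ C) ∧
        ∫⁻ z in Ioo 0 T ×ˢ K, ‖p z.1 z.2‖ₑ ^ (3 / 2 : ℝ) < (⊤ : ℝ≥0∞)) ∧
      (∃ G : ℝ → ℝ³ → ℝ³ →L[ℝ] ℝ³,
        FluidPDE.HasWeakSpatialGradientOn (FluidPDE.slab ℝ³ (Ioi 0) isOpen_Ioi) u G ∧
        ∀ K : Set ℝ³, IsCompact K → ∀ T : ℝ, 0 < T →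
          ∫⁻ z in Ioo 0 T ×ˢ K, ENNReal.ofReal (FluidPDE.frobeniusNormSq (G z.1 z.2)) < (⊤ : ℝ≥0∞))

/-- `chae_wolf_dss_existence` is the projection of `bradshawTsai2019_dss_existence` onto its
weak-solution, CKN-suitability and self-similarity clauses (Bradshaw–Tsai 2019, Thm 1.2; this
is the corrected provenance of the historical declaration). [cite: BradshawTsai2019, Thm 1.2] -/
theorem chae_wolf_dss_existence_of_bradshawTsai2019 (h : bradshawTsai2019_dss_existence) :
    chae_wolf_dss_existence := by
  intro c hc u₀ hmeas hL2 hdiv hdss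
  obtain ⟨u, p, hdssu, hweak, hsuit, -, -, -⟩ := h hc hmeas hL2 hdiv hdss
  exact ⟨u, p, hweak, hsuit, hdssu⟩

/-- **ns.S26** (Chae–Wolf, *Existence of discretely self-similar solutions to the Navier–Stokes
equations for initial value in `L²_loc(ℝ³)`*, arXiv:1610.01386 (v1) = Ann. Inst. H. Poincaré C
Anal. Non Linéaire 35 (2018) 1019–1039, **Theorem 1.4** with **Definition 1.2** (arXiv
numbering)). Theorem 1.4: for any `λ`-DSS initial datum `u₀ ∈ L²_{loc,σ}(ℝ³)` (`λ > 1`) there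
exists at least one *local Leray solution with projected pressure*
`u ∈ L²_{loc,σ}(ℝ³ × [0, ∞))` of the Navier–Stokes equations (`ν = 1`, `f = 0`) in the sense of
Definition 1.2, which is discretely self-similar. Definition 1.2 asks, for every bounded `C²`
domain `G` and `0 < T < ∞`: (1) `u ∈ L^∞(0,T; L²(G)) ∩ L²(0,T; W^{1,2}(G))`, divergence free,
and `u ∈ C_w([0,T]; L²(G))`; (2) `∫∫ (−u·∂ₜφ − u⊗u:∇φ + ∇u:∇φ) = 0` for all divergence-free
`φ ∈ C_c^∞(ℝ³ × (0,∞))`; (3) `u(t) → u₀` in `L²(G)` as `t → 0⁺`; (4) the local energy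
inequality *with projected pressure* (1.11) for `v_G = u + ∇p_{h,G}`, `∇p_{h,G} = −E*_G(u)`
(Stokes pressure projection). Rendering (module docstring, "Forward DSS existence"): (1)–(3)
are recorded as the pressure-free weak solution with datum `Fluid.IsWeakNSSolutionOn T 1 0 u₀ u`
for every `T > 0` (which they imply by a cut-off in time), the `∀ᵐ t ∈ (0,T)` bound on
`∫_K ‖u(t)‖²`, a weak spatial gradient in `L²((0,T) × K)` and `∫_K ‖u(t) − u₀‖² → 0`
(`t → 0⁺`) for all compact `K`, `T > 0`; `u` is `λ`-DSS on all of `ℝ × ℝ³`. **Omitted** (a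
weakening of the conclusion): the weak continuity in (1) and the projected-pressure inequality
(4) — the prelude has no Stokes projection `E*_G`. No pressure and no CKN inequality are
asserted: that refinement is Bradshaw–Tsai's `bradshawTsai2019_dss_existence`, which implies
this statement (`chaeWolf2018_dss_existence_of_bradshawTsai2019`). [cite: ChaeWolf2018, Thm 1.4] -/
def chaeWolf2018_dss_existence : Prop :=
  ∀ {c : ℝ}, 1 < c → ∀ {u₀ : ℝ³ → ℝ³}, AEStronglyMeasurable u₀ volume →
    LocallyIntegrable (fun x => ‖u₀ x‖ ^ 2) volume → FluidPDE.IsWeaklyDivFree u₀ →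
      FluidPDE.nsRescaleData c u₀ = u₀ →
    ∃ u : ℝ → ℝ³ → ℝ³,
      FluidPDE.IsDiscretelySelfSimilar c u ∧
      (∀ T : ℝ, 0 < T → FluidPDE.IsWeakNSSolutionOn T 1 0 u₀ u) ∧
      (∀ K : Set ℝ³, IsCompact K →
        Tendsto (fun t => ∫⁻ x in K, ‖u t x - u₀ x‖ₑ ^ 2) (𝓝[>] 0) (𝓝 0)) ∧
      (∀ K : Set ℝ³, IsCompact K → ∀ T : ℝ, 0 < T →
        ∃ C : ℝ≥0, ∀ᵐ t ∂(volume.restrict (Ioo 0 T)), ∫⁻ x in K, ‖u t x‖ₑ ^ 2 ≤ C) ∧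
      (∃ G : ℝ → ℝ³ → ℝ³ →L[ℝ] ℝ³,
        FluidPDE.HasWeakSpatialGradientOn (FluidPDE.slab ℝ³ (Ioi 0) isOpen_Ioi) u G ∧
        ∀ K : Set ℝ³, IsCompact K → ∀ T : ℝ, 0 < T →
          ∫⁻ z in Ioo 0 T ×ˢ K, ENNReal.ofReal (FluidPDE.frobeniusNormSq (G z.1 z.2)) < (⊤ : ℝ≥0∞))

/-- Bradshaw–Tsai's theorem refines Chae–Wolf's at the level of these renderings: a `λ`-DSS
CKN-suitable solution with the stated energy classes and attainment of the datum is in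
particular a solution in the (rendered) Chae–Wolf class (Bradshaw–Tsai arXiv:1801.08060,
Comments on Thm 1.2, first item: "a slight refinement of the main result of [Chae–Wolf]"). [cite: BradshawTsai2019, Comments on Thm 1.2] -/
theorem chaeWolf2018_dss_existence_of_bradshawTsai2019 (h : bradshawTsai2019_dss_existence) :
    chaeWolf2018_dss_existence := by
  intro c hc u₀ hmeas hL2 hdiv hdss
  obtain ⟨u, p, hdssu, hweak, -, hdatum, hclass, hgrad⟩ := h hc hmeas hL2 hdiv hdss
  exact ⟨u, hdssu, hweak, hdatum, fun K hK T hT => (hclass K hK T hT).1, hgrad⟩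

/-! ## ns.S25: axisymmetric flows with swirl -/

/-- **ns.S25** (AX) (global regularity for axisymmetric data *with swirl*, wall
`summits/ns-w-axisym-swirl/SUMMIT.md`; Koch–Nadirashvili–Seregin–Šverák 2009, §5–6 for the
context; the no-swirl case is the accepted theorem `NS.axisymmetric_no_swirl_global_regularity`,
ns.S24). Take `ν > 0`. For every smooth, divergence-free, rapidly decaying (Fefferman's (4)),
axisymmetric datum `u₀ : ℝ³ → ℝ³` the Navier–Stokes equations with `f = 0` have a global
classical solution `(u, p)` on `ℝ³ × [0, ∞)` (jointly `C^∞`, part of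
`Fluid.IsClassicalNSSolutionOn (Ici 0)`) with `u(0) = u₀` and bounded energy. **Open** — the
axisymmetric case of Clay (A); `def` only. **Transitional duplicate** of the canonical
`Summit.NavierStokesRegularity.NavierStokesRegularity.AxisymmetricSwirlRegularity` (leaf file
`Summits/NavierStokesRegularity/NavierStokesRegularity/Theorems/AxisymmetricSwirlRegularity.lean`,
same definiens; conjecture/notion split of 2026-08-15); no declaration of `Literature/` mentions
this copy, which awaits deletion by the conjecture migration; new developments must use the
canonical name. [folklore] -/
@[conjecture] def AxisymmetricSwirlRegularity : Prop :=
  ∀ ν : ℝ, 0 < ν → ∀ u₀ : ℝ³ → ℝ³, ContDiff ℝ ∞ u₀ → VectorCalculus.IsDivFree u₀ →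
    HasRapidSpatialDecay u₀ → FluidPDE.IsAxisymmetric u₀ →
      ∃ (u : ℝ → ℝ³ → ℝ³) (p : ℝ → ℝ³ → ℝ),
        FluidPDE.IsClassicalNSSolutionOn (Ici 0) ν 0 u p ∧ u 0 = u₀ ∧ HasBoundedEnergy u

/-- **ns.S25** (AX-L) (Liouville problem for axisymmetric bounded ancient solutions with bounded
swirl; wall `summits/ns-w-axisym-swirl/SUMMIT.md`). **Open problem** — a `def`, not a fact:
nothing in print proves this statement (status checked 2026-08 against the sources below).
**Provenance.** Koch–Nadirashvili–Seregin–Šverák, Acta Math. 203 (2009) = arXiv:0709.3599, §5,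
arXiv p. 10, between the proof of Theorem 5.2 and Theorem 5.3: "The validity of Theorem 5.2 in
the absence of the 'no swirl' assumption is still an open problem. The following theorem,
however, is a partial result in that direction" (Theorem 5.3 = `knss_bound_C_over_r`: under
`|u| ≤ C/r` one gets `u = 0`); Seregin–Šverák, Comm. PDE 34 (2009) = arXiv:0804.1803, p. 3: "we
have not been able to fully prove Conjecture (L) in the axi-symmetric case so far". KNSS's open
problem carries *no* bound on the swirl; the present statement is its sub-problem with the extra
hypothesis `Γ = r u_θ ∈ L^∞`, the form studied by Lei–Ren–Zhang (arXiv:1902.11229, §1, remark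
after Thm 1.1: `Γ` obeys the maximum principle and is scaling invariant, so an `L^∞` bound
persists from the data and survives blow-up limits — "essentially not a restriction"; Zhang–Pan,
Anal. Theory Appl. 38 (2022), §3: "one can add the extra condition `Γ ∈ L^∞_t L^∞_x` without
losing much generality"). **Partial results in print** (none reaches this statement): KNSS 2009,
Thm 5.3 (`|u| ≤ C/r`); Lei–Zhang–Zhao 2017 (`Γ ∈ L^∞_t L^p_x` for some `p < ∞` forces `u`
constant; Zhang–Pan 2022, Thm 3.5); Lei–Ren–Zhang arXiv:1902.11229, Thm 1.1 (= Math. Ann. 383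
(2022) 415–431: if moreover `u` is periodic in `z` then `u = c e_z`) and Thm 1.2 (= Sci. Sin.
Math. 51 (2021) 971–984: under the rate condition `|Γ² − limsup_{r→∞} Γ²| ≤ ε₀ r⁻¹ limsup Γ²`);
Zhang–Pan 2022, p. 12: "the remaining case for the Liouville property, which is also the most
difficult one, is when `Γ` does not decay near infinity … the result cannot yet reach the full
conjecture in [KNSS]". **Statement.** Every bounded ancient mild solution
`u ∈ L^∞(ℝ³ × (−∞, 0))` (measurable slices) of Navier–Stokes (`ν = 1`) which is axisymmetric at
every `t < 0` and whose swirl `Γ = r u_θ = x₀u₁ − x₁u₀` (`swirl`, junk-free) is bounded on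
`(−∞, 0) × ℝ³` is constant — spatially a.e. constant on every slice `t < 0`, the rendering of
"constant" forced by the duality-form class (module docstring; KNSS 2009, Thm 5.2 likewise
concludes `(0, 0, b(t))`). As for `knss_axisymmetric_no_swirl` versus
`knss2009_axisymmetric_no_swirl`, the slice-wise measurability class is slightly larger than
print's jointly measurable `L^∞(ℝ³ × (−∞, 0))`; for an open `Prop` this only strengthens the
conjecture recorded. With `Γ ≡ 0` this is (the `ℝ³`-valued form of) Theorem 5.2
(`AxisymmetricLiouvilleBoundedSwirl.of_hasNoSwirl`), and conjecture (L) implies it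
(`LiouvilleConjectureNS.axisymmetricLiouvilleBoundedSwirl`) — both in
`SelfSimilarLiouvilleConsequences.lean`, stated for the canonical conjectures. **Transitional
duplicate.** Since the conjecture/notion split of 2026-08-15 the CANONICAL statement of this open
problem is `Summit.NavierStokesRegularity.NavierStokesRegularity.AxisymmetricLiouvilleBoundedSwirl`
(leaf file `Summits/NavierStokesRegularity/NavierStokesRegularity/Theorems/AxisymmetricLiouvilleBoundedSwirl.lean`,
same definiens); no declaration of `Literature/` mentions this copy any more (the four sanity
implications `AxisymmetricLiouvilleBoundedSwirl.…` below take the statement written out as their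
hypothesis), and it awaits deletion by the conjecture migration; new developments must use the
canonical name. [cite: KochNadirashviliSereginSverak2009, §5, arXiv p. 10 (after Thm 5.2): stated OPEN without the no-swirl assumption; bounded-Γ form Lei–Ren–Zhang arXiv:1902.11229 §1; status Zhang–Pan 2022 §3] -/
@[conjecture] def AxisymmetricLiouvilleBoundedSwirl : Prop :=
  ∀ u : ℝ → ℝ³ → ℝ³, FluidPDE.IsBoundedAncientMildSolution 1 u →
    (∀ t < 0, AEStronglyMeasurable (u t) volume) →
      (∀ t < 0, FluidPDE.IsAxisymmetric (u t)) →
        (∃ C : ℝ, ∀ t < 0, ∀ x, |FluidPDE.swirl (u t) x| ≤ C) →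
          ∀ t < 0, ∃ b : ℝ³, u t =ᵐ[volume] fun _ => b

-- `LiouvilleConjectureNS.axisymmetricLiouvilleBoundedSwirl` ((L) ⇒ (AX-L)) and
-- `AxisymmetricLiouvilleBoundedSwirl.of_hasNoSwirl` ((AX-L) contains the `ℝ³`-valued no-swirl
-- theorem) MOVED (conjecture/notion split, 2026-08-15) to `SelfSimilarLiouvilleConsequences.lean`,
-- stated for the canonical `Summit.NavierStokesRegularity.NavierStokesRegularity.{LiouvilleConjectureNS,
-- AxisymmetricLiouvilleBoundedSwirl}`.

/-- KNSS's Theorem 5.2 yields the `ℝ³`-valued slice-wise constancy predicted by (L) and (AX-L)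
(take `b = β • e_z`; sanity bridge between the two shapes of conclusion used in this file).
**Class (as for `knss_axisymmetric_no_swirl`).** The hypotheses — measurable *slices* only — are
formally weaker than print's `u ∈ L^∞(ℝ³ × (−∞, 0))` (joint measurability, KNSS 2009, arXiv p. 7
and §4 (ii) p. 8); the statement nevertheless follows from the theorem as printed,
`knss_axisymmetric_no_swirl'_of_KNSS2009` (`KNSSThm52SliceBridge`, proved; through
`knss_axisymmetric_no_swirl_of_KNSS2009` with `b = β • e_z`), hence from KNSS's §4 regularity
fact alone (`knss_axisymmetric_no_swirl'_of_prop41_mild`), and from `knss_axisymmetric_no_swirl`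
(`knss_axisymmetric_no_swirl'_of_knss_axisymmetric_no_swirl`, `SelfSimilarLiouvilleProofs`). The
print-faithful rendering carrying the joint measurability hypothesis is
`knss2009_axisymmetric_no_swirl'` below, which this one trivially implies
(`knss_axisymmetric_no_swirl'.knss2009`). [folklore] -/
def knss_axisymmetric_no_swirl' : Prop :=
  ∀ {u : ℝ → ℝ³ → ℝ³} (hu : FluidPDE.IsBoundedAncientMildSolution 1 u) (hmeas : ∀ t < 0, AEStronglyMeasurable (u t) volume) (haxi : ∀ t < 0, FluidPDE.IsAxisymmetric (u t)) (hswirl : ∀ t < 0, FluidPDE.HasNoSwirl (u t)),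
    ∀ t < 0, ∃ b : ℝ³, u t =ᵐ[volume] fun _ => b

/- interim proof relied on results that are now named facts (D-0014); demoted to a fact by the M5 import, proof preserved:
:= fun t ht =>
  let ⟨β, hβ⟩ := knss_axisymmetric_no_swirl hu hmeas haxi hswirl t ht
  ⟨β • Fluid.eZ, hβ⟩
-/

/-! ## ns.S22, Theorem 5.2 in the tree's mild class: the corrected statement -/

/-- **ns.S22, corrected rendering of KNSS 2009, Theorem 5.2 in the duality-form class**
(Koch–Nadirashvili–Seregin–Šverák, Acta Math. 203 (2009) = arXiv:0709.3599, Theorem 5.2: "Let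
`u` be a bounded weak solution of the Navier–Stokes equations in `ℝ³ × (−∞, 0)`. Assume that `u`
is axi-symmetric with no swirl. Then `u(x,t) = (0, 0, b₃(t))` for some bounded measurable
`b₃`"). **Discrepancy with `knss_axisymmetric_no_swirl`.** In print `u` is an element of
`L^∞(ℝ³ × (−∞, 0))` — a *jointly* measurable bounded space–time field (arXiv p. 7, the
definition of weak solutions: "a bounded measurable vector field `u : ℝⁿ × (0,T) → ℝⁿ`"; §4 (i)–(ii),
p. 8: `u ∈ L^∞_{x,t}(ℝⁿ × (0,T))`). The fact `knss_axisymmetric_no_swirl` asks only for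
measurable *slices* `u t`, `t < 0`; its solution class is then strictly larger than the printed
one: for a bounded **non-measurable** `β : ℝ → ℝ` the field `u(t, x) = β(t) e_z` satisfies every
hypothesis of `knss_axisymmetric_no_swirl` (every slice is constant; all pairings in the duality
identity `Fluid.IsMildNSSolutionBetween` vanish, since compactly supported divergence-free tests
and their caloric extensions have zero mean and `∫ ∂_z ψ_z = 0`), yet `u` is not a.e. equal to any
jointly measurable function, and for such fields the time integral of the duality identity is a
Bochner integral that may silently take its junk value `0`. The fact `knss_axisymmetric_no_swirl`
is therefore stated for a formally larger class than the source's; the two renderings are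
nevertheless equivalent in strength — `knss_axisymmetric_no_swirl_of_KNSS2009`
(`KNSSThm52SliceBridge`, proved) derives the slice-wise fact from the theorem as printed, the
possibly non-measurable drift being the only obstruction and a removable one (`AncientMildDrift`,
`AncientMildModification`). This print-faithful rendering adds the printed hypothesis
`u ∈ L^∞(ℝ³ × (−∞, 0))` as joint a.e.-strong measurability of `uncurry u` on the slab
`(−∞, 0) × ℝ³` (boundedness is already part of `Fluid.IsBoundedAncientMildSolution`); nothing else
is changed — measurable slices at *every* `t < 0` are kept (they are needed for the slice-wise
conclusion at every `t`, which the all-pairs duality identity then justifies, module docstring),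
the symmetry hypotheses stay pointwise, the conclusion is the same. With joint measurability the
duality-form class is contained in KNSS's class of bounded weak solutions (the time integrals are
honest and the two-time identity integrates to the space–time weak formulation), so this statement
is Theorem 5.2 transported to the tree's vocabulary; `knss_axisymmetric_no_swirl` trivially implies
it (`knss_axisymmetric_no_swirl.knss2009`). [cite: KochNadirashviliSereginSverak2009, Thm 5.2 (arXiv pp. 9–10) with §4 (ii) p. 8 (the class L^∞(ℝ³ × (−∞,0)))] -/
def knss2009_axisymmetric_no_swirl : Prop :=
  ∀ {u : ℝ → ℝ³ → ℝ³} (hu : FluidPDE.IsBoundedAncientMildSolution 1 u)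
    (hjoint : AEStronglyMeasurable (uncurry u) (volume.restrict (Iio (0 : ℝ) ×ˢ (univ : Set ℝ³))))
    (hmeas : ∀ t < 0, AEStronglyMeasurable (u t) volume)
    (haxi : ∀ t < 0, FluidPDE.IsAxisymmetric (u t)) (hswirl : ∀ t < 0, FluidPDE.HasNoSwirl (u t)),
    ∀ t < 0, ∃ β : ℝ, u t =ᵐ[volume] fun _ => β • FluidPDE.eZ

/-- The interim fact `knss_axisymmetric_no_swirl` (measurable slices only) implies its corrected,
print-faithful form `knss2009_axisymmetric_no_swirl` (which carries the additional hypothesis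
`u ∈ L^∞(ℝ³ × (−∞, 0))`, i.e. joint measurability): forget the extra hypothesis. [cite: KochNadirashviliSereginSverak2009, Thm 5.2 (arXiv pp. 9–10)] -/
theorem knss_axisymmetric_no_swirl.knss2009 (h : knss_axisymmetric_no_swirl) :
    knss2009_axisymmetric_no_swirl :=
  fun hu _ hmeas haxi hswirl => h hu hmeas haxi hswirl

/-- The corrected Theorem 5.2 yields the `ℝ³`-valued slice-wise constancy predicted by the
Liouville conjecture (L) for jointly measurable axisymmetric swirl-free bounded ancient mild
solutions (take `b = β • e_z`; the shape of `knss_axisymmetric_no_swirl'`). [cite: KochNadirashviliSereginSverak2009, Thm 5.2 (arXiv pp. 9–10)] -/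
theorem knss2009_axisymmetric_no_swirl.exists_const (h : knss2009_axisymmetric_no_swirl)
    {u : ℝ → ℝ³ → ℝ³} (hu : FluidPDE.IsBoundedAncientMildSolution 1 u)
    (hjoint : AEStronglyMeasurable (uncurry u) (volume.restrict (Iio (0 : ℝ) ×ˢ (univ : Set ℝ³))))
    (hmeas : ∀ t < 0, AEStronglyMeasurable (u t) volume)
    (haxi : ∀ t < 0, FluidPDE.IsAxisymmetric (u t)) (hswirl : ∀ t < 0, FluidPDE.HasNoSwirl (u t)) :
    ∀ t < 0, ∃ b : ℝ³, u t =ᵐ[volume] fun _ => b := fun t ht =>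
  let ⟨β, hβ⟩ := h hu hjoint hmeas haxi hswirl t ht
  ⟨β • FluidPDE.eZ, hβ⟩

/-! ## ns.S22, the `ℝ³`-valued corollary of Theorem 5.2: the corrected statement -/

/-- **ns.S22, corrected rendering of `knss_axisymmetric_no_swirl'` in the duality-form class**
(the `ℝ³`-valued slice-wise constancy drawn from Koch–Nadirashvili–Seregin–Šverák, Acta Math. 203
(2009) = arXiv:0709.3599, Theorem 5.2: "Let `u` be a bounded weak solution of the Navier–Stokes
equations in `ℝ³ × (−∞, 0)`. Assume that `u` is axi-symmetric with no swirl. Then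
`u(x,t) = (0, 0, b₃(t))` for some bounded measurable `b₃`"). **Discrepancy with
`knss_axisymmetric_no_swirl'`.** That fact (recorded as folklore: "KNSS's Theorem 5.2 yields the
`ℝ³`-valued slice-wise constancy predicted by (L) and (AX-L)") has letter for letter the
hypotheses of the interim `knss_axisymmetric_no_swirl` — measurable *slices* `u t`, `t < 0`, only —
whereas in print `u` is an element of `L^∞(ℝ³ × (−∞, 0))`, a *jointly* measurable bounded
space–time field (arXiv p. 7: "a bounded measurable vector field `u : ℝⁿ × (0,T) → ℝⁿ` is a weak
solution …"; §4 (ii), p. 8: `u ∈ L^∞_{x,t}(ℝⁿ × (0,T))`). As explained at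
`knss2009_axisymmetric_no_swirl`, the slice-wise class is strictly larger than the printed one
(for a bounded **non-measurable** `β : ℝ → ℝ` the field `u(t, x) = β(t) e_z` satisfies every
hypothesis, yet is not a.e. equal to any jointly measurable field, and for such fields the time
integral of the duality identity `Fluid.IsMildNSSolutionBetween` is a Bochner integral that may
silently take its junk value `0`), so `knss_axisymmetric_no_swirl'` is stated for a formally larger
class than the source's. It nevertheless follows from the theorem as printed:
`knss_axisymmetric_no_swirl'_of_KNSS2009` (`KNSSThm52SliceBridge`, proved) reduces the slice-wise
class to the printed one — subtracting the axial average `c(t) e_z` leaves a family with a jointly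
measurable modification `w` (`AncientMildModification`), the drift pairing
`c(t) · ∫ ⟪w(t), ∂_z e^{(t'−t)Δ}φ⟫` of the duality identity pins `c` measurably wherever it does
not vanish, and where it vanishes the slice is invariant under the vertical translations, so that
the drift lemma of `AncientMildDrift` replaces `c` by a measurable drift inside the class.
**This print-faithful rendering** is the one applied to Theorem 5.2 itself: add the
printed hypothesis `u ∈ L^∞(ℝ³ × (−∞, 0))` as joint a.e.-strong measurability of `uncurry u` on
the slab `(−∞, 0) × ℝ³` (boundedness is already part of `Fluid.IsBoundedAncientMildSolution`) and
change nothing else — measurable slices at every `t < 0`, pointwise symmetry hypotheses, and the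
`ℝ³`-valued a.e. conclusion at every `t < 0` (the rendering of "constant" forced by the
duality-form class, module docstring). The result is exactly the `ℝ³`-valued corollary of the
corrected fact `knss2009_axisymmetric_no_swirl` (take `b = β • e_z`:
`knss2009_axisymmetric_no_swirl'_of_knss2009`, i.e. `knss2009_axisymmetric_no_swirl.exists_const`),
hence Theorem 5.2 transported to the tree's vocabulary with the direction of the constant
forgotten, and it is discharged together with that fact (KNSS §4 regularity and Lemma 2.1,
`KNSSThm52Assembly`, `KNSSThm52OfWindow`); `knss_axisymmetric_no_swirl'` trivially implies it
(`knss_axisymmetric_no_swirl'.knss2009`), as does the Liouville conjecture (L)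
(`LiouvilleConjectureNS.knss2009_axisymmetric_no_swirl'`). [cite: KochNadirashviliSereginSverak2009, Thm 5.2 (arXiv pp. 9–10) with §3 p. 7 and §4 (ii) p. 8 (the class L^∞(ℝ³ × (−∞,0)))] -/
def knss2009_axisymmetric_no_swirl' : Prop :=
  ∀ {u : ℝ → ℝ³ → ℝ³} (hu : FluidPDE.IsBoundedAncientMildSolution 1 u)
    (hjoint : AEStronglyMeasurable (uncurry u) (volume.restrict (Iio (0 : ℝ) ×ˢ (univ : Set ℝ³))))
    (hmeas : ∀ t < 0, AEStronglyMeasurable (u t) volume)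
    (haxi : ∀ t < 0, FluidPDE.IsAxisymmetric (u t)) (hswirl : ∀ t < 0, FluidPDE.HasNoSwirl (u t)),
    ∀ t < 0, ∃ b : ℝ³, u t =ᵐ[volume] fun _ => b

/-- The corrected Theorem 5.2 (`knss2009_axisymmetric_no_swirl`: every slice is a.e. `β • e_z`)
implies its `ℝ³`-valued corollary `knss2009_axisymmetric_no_swirl'` (take `b = β • e_z`; this is
`knss2009_axisymmetric_no_swirl.exists_const` read as an implication between the two named facts).
[cite: KochNadirashviliSereginSverak2009, Thm 5.2 (arXiv pp. 9–10)] -/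
theorem knss2009_axisymmetric_no_swirl'_of_knss2009 (h : knss2009_axisymmetric_no_swirl) :
    knss2009_axisymmetric_no_swirl' :=
  fun hu hjoint hmeas haxi hswirl => h.exists_const hu hjoint hmeas haxi hswirl

/-- The interim fact `knss_axisymmetric_no_swirl'` (measurable slices only) implies its corrected,
print-faithful form `knss2009_axisymmetric_no_swirl'` (which carries the additional hypothesis
`u ∈ L^∞(ℝ³ × (−∞, 0))`, i.e. joint measurability): forget the extra hypothesis. [cite: KochNadirashviliSereginSverak2009, Thm 5.2 (arXiv pp. 9–10)] -/
theorem knss_axisymmetric_no_swirl'.knss2009 (h : knss_axisymmetric_no_swirl') :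
    knss2009_axisymmetric_no_swirl' :=
  fun hu _ hmeas haxi hswirl => h hu hmeas haxi hswirl

/-- The interim rendering of Theorem 5.2 (`knss_axisymmetric_no_swirl`) implies the corrected
`ℝ³`-valued corollary as well (through `knss_axisymmetric_no_swirl.knss2009`). [cite: KochNadirashviliSereginSverak2009, Thm 5.2 (arXiv pp. 9–10)] -/
theorem knss_axisymmetric_no_swirl.knss2009' (h : knss_axisymmetric_no_swirl) :
    knss2009_axisymmetric_no_swirl' :=
  knss2009_axisymmetric_no_swirl'_of_knss2009 h.knss2009

/-- The Liouville conjecture (L) contains the corrected `ℝ³`-valued corollary of Theorem 5.2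
(sanity implication: (L) concludes slice-wise constancy for every bounded ancient mild solution
with measurable slices; the joint measurability and symmetry hypotheses are carried but not used;
KNSS 2009, §1 and §5). **Hypothesis (conjecture/notion split 2026-08-15).** `hL` is the statement (L) written out — letter for letter the definiens of the canonical `Summit.NavierStokesRegularity.NavierStokesRegularity.LiouvilleConjectureNS` (and of the transitional copy `LiouvilleConjectureNS` above) —, so the theorem mentions neither `Prop` and applies verbatim (by unfolding) to a witness of the canonical conjecture; it keeps its name and place because its last name component is also the name of the fact it concludes, which importers discharge, so the gate's removal lint pins it to this file. [cite: KochNadirashviliSereginSverak2009, §1 and §5] -/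
theorem LiouvilleConjectureNS.knss2009_axisymmetric_no_swirl'
    (hL : ∀ u : ℝ → ℝ³ → ℝ³, FluidPDE.IsBoundedAncientMildSolution 1 u →
      (∀ t < 0, AEStronglyMeasurable (u t) volume) →
        ∀ t < 0, ∃ b : ℝ³, u t =ᵐ[volume] fun _ => b) :
    knss2009_axisymmetric_no_swirl' :=
  fun hu _ hmeas _ _ => hL _ hu hmeas

/-- The bounded-swirl axisymmetric Liouville problem (AX-L) likewise contains the corrected
`ℝ³`-valued corollary of Theorem 5.2 (its case `Γ ≡ 0`: take the swirl bound `C = 0`; the joint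
measurability is not used; the `ℝ³`-valued no-swirl form `AxisymmetricLiouvilleBoundedSwirl.of_hasNoSwirl`
is in `SelfSimilarLiouvilleConsequences.lean`). **Hypothesis (conjecture/notion split 2026-08-15).** `h` is the statement (AX-L) written out — letter for letter the definiens of the canonical `Summit.NavierStokesRegularity.NavierStokesRegularity.AxisymmetricLiouvilleBoundedSwirl` (and of the transitional copy `AxisymmetricLiouvilleBoundedSwirl` above) —, so the theorem mentions neither `Prop` and applies verbatim (by unfolding) to a witness of the canonical conjecture; it keeps its name and place because its last name component is also the name of the fact it concludes, which importers discharge, so the gate's removal lint pins it to this file. [cite: KochNadirashviliSereginSverak2009, §5 (Thm 5.2 is the swirl-free case of the open problem stated after it, arXiv p. 10)] -/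
theorem AxisymmetricLiouvilleBoundedSwirl.knss2009_axisymmetric_no_swirl'
    (h : ∀ u : ℝ → ℝ³ → ℝ³, FluidPDE.IsBoundedAncientMildSolution 1 u →
      (∀ t < 0, AEStronglyMeasurable (u t) volume) →
        (∀ t < 0, FluidPDE.IsAxisymmetric (u t)) →
          (∃ C : ℝ, ∀ t < 0, ∀ x, |FluidPDE.swirl (u t) x| ≤ C) →
            ∀ t < 0, ∃ b : ℝ³, u t =ᵐ[volume] fun _ => b) :
    knss2009_axisymmetric_no_swirl' :=
  fun hu _ hmeas haxi hswirl => h _ hu hmeas haxi ⟨0, fun t ht x => by simp [hswirl t ht x]⟩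

/-! ## ns.S25 (AX-L): the sub-cases proved in print (Lei–Zhang–Zhao 2017; Lei–Ren–Zhang 2019)

Four results in print on the bounded-swirl axisymmetric Liouville problem
`AxisymmetricLiouvilleBoundedSwirl`, vendored as named facts in the class of that statement —
bounded ancient mild solutions in duality form (`ν = 1`), measurable and pointwise axisymmetric
slices, pointwise hypotheses on the swirl `Γ = swirl (u t) = x₀u₁ − x₁u₀ = r u_θ`, slice-wise a.e.
conclusions `u(t, ·) = β e_z` (module docstring, "Design choices": the duality-form class does not
see a time-dependent axial constant, so print's "`v = c e_z`, `c` constant" becomes "`β(t) e_z` on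
every slice", exactly as KNSS's Theorem 5.2 is rendered by `knss_axisymmetric_no_swirl`):

* `leiZhangZhao2017_liouville_swirl_Lp` — Lei–Zhang–Zhao 2017, Theorem 1.3 (= Zhang–Pan 2022,
  Theorem 3.5): `Γ ∈ L^∞_t L^p_x`, `1 ≤ p < ∞`, forces `v` constant;
* `leiZhangZhao2017_liouville_swirl_decay` — Lei–Zhang–Zhao 2017, Remark 1.4 (the form invoked by
  Lei–Ren–Zhang 2019, §4): `Γ → 0` as `r → ∞` uniformly in `z, t` forces `v` constant;
* `leiRenZhang2019_liouville_swirl_rate` — Lei–Ren–Zhang arXiv:1902.11229, Theorem 1.2 (= Sci.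
  Sin. Math. 51 (2021) 971–984; Zhang–Pan 2022, Theorem 3.7): if `|Γ² − L²| ≤ ε₀ L²/r` for large
  `r`, uniformly in `z, t`, where `L² = lim sup_{r→∞} sup_{z,t} Γ²` and `ε₀ = ε₀(‖v‖_∞) ∈ (0,1)`,
  then `v = c e_z`;
* `leiRenZhang2019_swirl_sup_at_infinity` — Lei–Ren–Zhang arXiv:1902.11229, §1 p. 4 and §4 p. 10
  (restated in Zhang–Pan 2022, p. 12): for a bounded ancient solution with bounded `Γ`,
  `lim sup_{r→∞} sup_{z,t} |Γ| = sup |Γ|` — the swirl supremum is approached at radial infinity.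

In print the solutions are KNSS's bounded ancient *mild* solutions, which are smooth
(Lei–Ren–Zhang 2019, §1: "these solutions are smooth in space-time if they are bounded"; KNSS
2009, §2–4), and `Γ = r v_θ` is a genuine continuous function. The renderings are consequences of
the printed theorems in the same way as `knss_axisymmetric_no_swirl` is a consequence of KNSS's
Theorem 5.2 (`KNSSThm52SliceBridge`, `AncientMildDrift`, `AncientMildModification`): an
everywhere-defined field of the class differs on every slice from a smooth KNSS-mild solution by a
null set and an axial drift `β(t) e_z` (removable by an axial Galilean change of frame, which does
not move `Γ`, `r` or suprema over `z`); pointwise bounds on the field are a.e. bounds, hence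
everywhere bounds, for the continuous representative; and `L^p` norms and measures of superlevel
sets of `|Γ(t, ·)|` do not see null sets. Accordingly hypotheses are pointwise (formally stronger
than print's, which concern the smooth representative) and the one conclusion about a supremum
(`leiRenZhang2019_swirl_sup_at_infinity`) is phrased through positive-measure superlevel sets,
i.e. slice-wise essential suprema (a pointwise supremum of an arbitrary representative is
meaningless: the swirl may be changed on a circle `{R_θ x₀}` without leaving the class).
Sanity theorems (proved): each Liouville piece contains the tree's rendering of KNSS's Theorem 5.2
(`….knss_axisymmetric_no_swirl`), and the open problem (AX-L) contains each piece
(`AxisymmetricLiouvilleBoundedSwirl.…`; since the conjecture/notion split of 2026-08-15 these take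
the statement (AX-L) written out as their hypothesis `h` — the definiens of the canonical
`Summit.NavierStokesRegularity.NavierStokesRegularity.AxisymmetricLiouvilleBoundedSwirl` letter for
letter —, so that they mention no conjecture `Prop` and apply verbatim to a witness of the canonical
one). -/

/-- `|Γ(x)| = |x₀v₁(x) − x₁v₀(x)| ≤ r ‖v(x)‖`: the swirl is the horizontal cross product, bounded by
Cauchy–Schwarz in the horizontal plane (so `|Γ| ≤ r ‖v‖_∞` for a bounded field: the swirl of a
bounded field is small near the axis; Lei–Ren–Zhang 2019, §4 and Lei–Zhang–Zhao 2017, proof of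
Lemma 5.2 use that `Γ = 0` on the axis). The variant with an axial drift is
`abs_swirl_le_cylRadius_mul_norm_add_smul_eZ` (`KNSSSwirlLiouville`). [folklore] -/
theorem abs_swirl_le_cylRadius_mul_norm (v : ℝ³ → ℝ³) (x : ℝ³) :
    |FluidPDE.swirl v x| ≤ FluidPDE.cylRadius x * ‖v x‖ := by
  have hr : FluidPDE.cylRadius x ^ 2 = x 0 ^ 2 + x 1 ^ 2 := FluidPDE.cylRadius_sq x
  have hn : ‖v x‖ ^ 2 = v x 0 ^ 2 + v x 1 ^ 2 + v x 2 ^ 2 := by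
    rw [EuclideanSpace.real_norm_sq_eq, Fin.sum_univ_three]
  refine abs_le_of_sq_le_sq ?_ (mul_nonneg (FluidPDE.cylRadius_nonneg x) (norm_nonneg _))
  rw [mul_pow, hr, hn, FluidPDE.swirl]
  nlinarith [sq_nonneg (x 0 * v x 0 + x 1 * v x 1), sq_nonneg (v x 2),
    add_nonneg (sq_nonneg (x 0)) (sq_nonneg (x 1))]

/-- **Lei–Zhang–Zhao 2017, Theorem 1.3** (Z. Lei, Q. S. Zhang, N. Zhao, *Improved Liouville
theorems for axially symmetric Navier–Stokes equations*, arXiv:1701.00868 = Sci. Sin. Math. 47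
(2017), Theorem 1.3, arXiv p. 4: "Let `v` be a bounded ancient mild solution of the 3D axially
symmetric Navier–Stokes equations with `v_θ ≠ 0` and let `Γ = r v_θ`. If
`Γ ∈ L^∞_t L^p_x(ℝ³ × (−∞, 0))` where `1 ≤ p < ∞`, then `v` must be a constant"; restated as
Zhang–Pan, Anal. Theory Appl. 38 (2022), Theorem 3.5. The clause "`v_θ ≠ 0`" only names the case
treated — the conclusion forces `v_θ ≡ 0` — and is not a hypothesis. Proof in print, §5: Lemma 5.1
(Moser iteration for `∂ₜΓ + b·∇Γ + (2/r)∂ᵣΓ − ΔΓ = 0`: `|Γ| ≤ C r^{-1/p}`, so `Γ → 0` as `r → ∞`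
uniformly in `t, z`) and Lemma 5.2 (maximum principle and a compactness/contradiction argument:
`Γ ≡ 0`, then KNSS 2009, Theorem 5.2).) **Statement.** Every bounded ancient mild solution `u` of
Navier–Stokes (`ν = 1`) on `ℝ³ × (−∞, 0)` with measurable, axisymmetric slices whose swirl
satisfies `sup_{t<0} ‖Γ(t, ·)‖_{L^p(ℝ³)} < ∞` for some `1 ≤ p < ∞` is, on every slice `t < 0`, a.e.
equal to an axial constant `β e_z` (the rendering of "constant" in the duality-form class; an
axisymmetric constant is axial). The slice-wise `sup_t` is formally stronger than print's
`ess sup_t`, and `‖Γ(t, ·)‖_{L^p}` does not depend on the representative of the slice (section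
docstring). [cite: LeiZhangZhao2017, Thm 1.3 (arXiv p. 4) with Lemmas 5.1–5.2 (pp. 10–12); ZhangPan2022, Thm 3.5] -/
def leiZhangZhao2017_liouville_swirl_Lp : Prop :=
  ∀ u : ℝ → ℝ³ → ℝ³, FluidPDE.IsBoundedAncientMildSolution 1 u →
    (∀ t < 0, AEStronglyMeasurable (u t) volume) →
      (∀ t < 0, FluidPDE.IsAxisymmetric (u t)) →
        (∃ (p : ℝ≥0∞) (K : ℝ≥0), 1 ≤ p ∧ p < (⊤ : ℝ≥0∞) ∧
            ∀ t < 0, eLpNorm (FluidPDE.swirl (u t)) p volume ≤ K) →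
          ∀ t < 0, ∃ β : ℝ, u t =ᵐ[volume] fun _ => β • FluidPDE.eZ

/-- **Lei–Zhang–Zhao 2017, Remark 1.4** (arXiv:1701.00868 = Sci. Sin. Math. 47 (2017), Remark 1.4,
arXiv p. 4: "If `lim_{r→∞} Γ = 0` uniformly, the conclusion in Theorem 1.3 still holds"; the
abstract and §1: "if `Γ = r v_θ ∈ L^∞_t L^p_x` …, or `lim_{r→∞} Γ = 0` uniformly, then bounded
ancient mild solutions are constants"; this is the content of Lemma 5.2, whose proof uses of Lemma
5.1 only its conclusion "`lim_{r→∞} Γ = 0` uniformly for `t` and `z`". It is the form in which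
Lei–Ren–Zhang arXiv:1902.11229, §4 (p. 10 and the last lines of the proof of Theorem 1.2) invoke
the result: "Then [LZZ] Theorem 1.3, Remark 1.4, will imply that `v = c e_z`".) **Statement.** Every
bounded ancient mild solution `u` of Navier–Stokes (`ν = 1`) on `ℝ³ × (−∞, 0)` with measurable,
axisymmetric slices whose swirl tends to zero at radial infinity uniformly in `z` and `t` — for
every `ε > 0` there is `R` with `|Γ(t, x)| ≤ ε` whenever `t < 0` and `r(x) ≥ R` — is, on every slice
`t < 0`, a.e. equal to an axial constant `β e_z`. (No separate bound on `Γ` is needed: `|Γ| ≤ r‖u‖`,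
`abs_swirl_le_cylRadius_mul_norm`, bounds it near the axis; this is how
`AxisymmetricLiouvilleBoundedSwirl.leiZhangZhao2017_liouville_swirl_decay` places the statement
under (AX-L).) [cite: LeiZhangZhao2017, Remark 1.4 (arXiv p. 4) with Lemma 5.2 (pp. 11–12); LeiRenZhang2019, §4 p. 10] -/
def leiZhangZhao2017_liouville_swirl_decay : Prop :=
  ∀ u : ℝ → ℝ³ → ℝ³, FluidPDE.IsBoundedAncientMildSolution 1 u →
    (∀ t < 0, AEStronglyMeasurable (u t) volume) →
      (∀ t < 0, FluidPDE.IsAxisymmetric (u t)) →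
        (∀ ε : ℝ, 0 < ε → ∃ R : ℝ, ∀ t < 0, ∀ x, R ≤ FluidPDE.cylRadius x →
            |FluidPDE.swirl (u t) x| ≤ ε) →
          ∀ t < 0, ∃ β : ℝ, u t =ᵐ[volume] fun _ => β • FluidPDE.eZ

/-- **Lei–Ren–Zhang 2019, Theorem 1.2** (Z. Lei, X. Ren, Q. S. Zhang, *On ancient periodic
solutions to axially-symmetric Navier–Stokes equations*, arXiv:1902.11229, Theorem 1.2, p. 4 —
published as *Liouville type theorems for axially symmetric Navier–Stokes equations*, Sci. Sin.
Math. 51 (2021) 971–984; restated as Zhang–Pan, Anal. Theory Appl. 38 (2022), Theorem 3.7: "Let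
`v = v_θ e_θ + v_r e_r + v_z e_z` be a bounded mild ancient solution to the ASNS such that
`Γ = r v_θ` is bounded. There exists a small number `ε₀ ∈ (0, 1)`, depending only on `‖v‖_∞`, such
that if `|Γ²(r, z, t) − lim sup_{r→∞} Γ²| ≤ (ε₀/r) lim sup_{r→∞} Γ²` holds uniformly for `z`, `t`,
and large `r`, then `v = c e_z` where `c` is a constant", with (p. 4)
`lim sup_{r→∞} Γ := lim sup_{r→∞} sup_{z,t} Γ(r, z, t)`; in the proof (§4, p. 10) the quantity is
`(lim sup_{r→∞} sup_{z,t} |Γ|)²`, normalised to `1`, and the hypothesis reads `|Γ² − 1| ≤ ε/r`.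
Proof in print, §4: a weighted energy estimate for `Γ` against the measure `λ(r) dr dz` with a
weight solving an auxiliary backward parabolic problem shows `lim sup_{r→∞} Γ = 0`, and
Lei–Zhang–Zhao's Remark 1.4 (`leiZhangZhao2017_liouville_swirl_decay`) concludes.) **Statement.**
For every bound `M` there is `ε₀ ∈ (0, 1)` such that: every bounded ancient mild solution `u` of
Navier–Stokes (`ν = 1`) on `ℝ³ × (−∞, 0)` with `‖u‖ ≤ M`, measurable axisymmetric slices and bounded
swirl, for which there are `L` and `R₀` with `|Γ(t, x)² − L²| ≤ ε₀ L² / r(x)` whenever `t < 0` and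
`r(x) ≥ R₀`, is on every slice `t < 0` a.e. equal to an axial constant `β e_z`. **Rendering of the
rate condition.** Print fixes `L² = lim sup_{r→∞} sup_{z,t} Γ²`; but if the displayed bound holds for
large `r` with *some* constant `L²`, then `sup_{z,t} |Γ²(r, ·, ·) − L²| ≤ ε₀L²/r → 0`, so `L²` *is*
`lim_{r→∞} sup_{z,t} Γ²` — the existential form is equivalent to the printed one and avoids a
`limsup` of suprema over cylinders. (`R₀` may always be increased, so the junk value of `·/r` on the
axis is never met for `R₀ > 0`.) The velocity bound is pointwise on `(−∞, 0) × ℝ³` (formally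
stronger than `‖v‖_∞` of the smooth representative; section docstring). Since the conclusion
forces `Γ = 0` a.e., the theorem says in effect that the rate condition cannot hold with `L ≠ 0`. [cite: LeiRenZhang2019, Thm 1.2 (arXiv p. 4) and §4 (pp. 10–12); ZhangPan2022, Thm 3.7] -/
def leiRenZhang2019_liouville_swirl_rate : Prop :=
  ∀ M : ℝ, ∃ ε₀ ∈ Set.Ioo (0 : ℝ) 1, ∀ u : ℝ → ℝ³ → ℝ³,
    FluidPDE.IsBoundedAncientMildSolution 1 u → (∀ t < 0, ∀ x, ‖u t x‖ ≤ M) →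
      (∀ t < 0, AEStronglyMeasurable (u t) volume) →
        (∀ t < 0, FluidPDE.IsAxisymmetric (u t)) →
          (∃ C : ℝ, ∀ t < 0, ∀ x, |FluidPDE.swirl (u t) x| ≤ C) →
            (∃ L R₀ : ℝ, ∀ t < 0, ∀ x, R₀ ≤ FluidPDE.cylRadius x →
                |FluidPDE.swirl (u t) x ^ 2 - L ^ 2| ≤ ε₀ * L ^ 2 / FluidPDE.cylRadius x) →
              ∀ t < 0, ∃ β : ℝ, u t =ᵐ[volume] fun _ => β • FluidPDE.eZ

/-- **Lei–Ren–Zhang 2019, §4: the swirl supremum is approached at radial infinity**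
(arXiv:1902.11229, §1 p. 4: "It will be shown in Section 4 that if `v` is any bounded ancient
solution such that `Γ` is bounded, then `lim sup_{r→∞} Γ = sup Γ`", where
`lim sup_{r→∞} Γ := lim sup_{r→∞} sup_{z,t} Γ(r, z, t)`; restated verbatim in Zhang–Pan, Anal.
Theory Appl. 38 (2022), p. 12, before Theorem 3.7; proved in §4, p. 10, first observation of the
proof of Theorem 1.2, in the form `lim sup_{r→∞, z, t→t_∞} |Γ| = sup_{r,z,t} |Γ|`: "Otherwise there
would be a bounded sequence `{r_i}`, `z_i` and `t_i → t_∞` such that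
`lim |Γ(r_i, z_i, t_i)| = sup |Γ|`. Consider the translated sequence `Γ_i(r, z, t) = Γ(r, z, t + t_i)`.
Then … a subsequence … converges, in `C^{2,1}_loc` topology, to `Γ_∞` which is a bounded ancient
solution of `ΔΓ_∞ − b̄∇Γ_∞ − (2/r)∂ᵣΓ_∞ − ∂ₜΓ_∞ = 0` … `Γ_∞` reaches nonzero interior maximum away
from the `z` axis … Hence `Γ_∞` is a nonzero constant by the maximum principle. This contradicts
with the fact that `Γ_∞ = 0` at the `z` axis." The argument is written for `|Γ|` (equivalently for
`Γ` when `sup Γ > 0` and for `−Γ` when `inf Γ < 0`; it needs the extremal value to be non-zero),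
which is the form recorded here; `|Γ| ≤ r ‖v‖_∞` keeps the near-maximum points off the axis.)
**Statement.** Let `u` be a bounded ancient mild solution of Navier–Stokes (`ν = 1`) on
`ℝ³ × (−∞, 0)` with measurable axisymmetric slices and bounded swirl `Γ`. Then for every level `ℓ`
and every radius `R`: if `ℓ` lies below the supremum of `|Γ|` — some slice `t₀ < 0` has
`{x | ℓ < |Γ(t₀, x)|}` of positive measure — then `|Γ|` exceeds `ℓ` beyond radius `R` as well — some
slice `t < 0` has `{x | r(x) ≥ R, ℓ < |Γ(t, x)|}` of positive measure. Equivalently,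
`ess sup_{t<0, x} |Γ| = lim_{R→∞} ess sup_{t<0, r(x)≥R} |Γ| (= lim sup_{r→∞} sup_{z,t} |Γ|` for the
continuous representative`)`. **Rendering.** The slices of a field of the duality-form class are
determined only up to null sets (and the swirl of an arbitrary representative may be altered on a
circle `{R_θ x₀}` inside the class), so print's suprema of the continuous `Γ = r v_θ` are rendered
as slice-wise essential suprema through positive-measure superlevel sets; for the continuous
representative the two readings agree (a superlevel set `{ℓ < |Γ(t, ·)|}`, or its part beyond
radius `R`, is open up to the boundary circle `r = R` and is null iff empty; section docstring).
For `ℓ < 0` the statement is trivial (`{r ≥ R}` has positive measure,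
`measure_setOf_le_cylRadius_pos`); its content is for `0 ≤ ℓ < ess sup |Γ|`. [cite: LeiRenZhang2019, §1 p. 4 (statement) and §4 p. 10 (proof); ZhangPan2022, p. 12] -/
def leiRenZhang2019_swirl_sup_at_infinity : Prop :=
  ∀ u : ℝ → ℝ³ → ℝ³, FluidPDE.IsBoundedAncientMildSolution 1 u →
    (∀ t < 0, AEStronglyMeasurable (u t) volume) →
      (∀ t < 0, FluidPDE.IsAxisymmetric (u t)) →
        (∃ C : ℝ, ∀ t < 0, ∀ x, |FluidPDE.swirl (u t) x| ≤ C) →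
          ∀ ℓ R : ℝ, (∃ t₀ < 0, 0 < volume {x | ℓ < |FluidPDE.swirl (u t₀) x|}) →
            ∃ t < 0, 0 < volume {x | R ≤ FluidPDE.cylRadius x ∧ ℓ < |FluidPDE.swirl (u t) x|}

/-! ### Each Liouville piece contains KNSS's Theorem 5.2 (tree rendering) -/

/-- Lei–Zhang–Zhao's Theorem 1.3 contains the (axial form of the) swirl-free theorem
`knss_axisymmetric_no_swirl`: a swirl-free field has `Γ ≡ 0 ∈ L^∞_t L¹_x` (sanity implication; in
print Theorem 1.3 is *reduced* to KNSS's Theorem 5.2, arXiv:1701.00868, end of §5). [cite: LeiZhangZhao2017, Thm 1.3 and end of §5 (arXiv p. 12)] -/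
theorem leiZhangZhao2017_liouville_swirl_Lp.knss_axisymmetric_no_swirl
    (h : leiZhangZhao2017_liouville_swirl_Lp) : knss_axisymmetric_no_swirl := by
  intro u hu hmeas haxi hswirl
  refine h u hu hmeas haxi ⟨1, 0, le_rfl, ENNReal.one_lt_top, fun t ht => ?_⟩
  have h0 : FluidPDE.swirl (u t) = 0 := funext fun x => hswirl t ht x
  rw [h0, eLpNorm_zero]
  exact bot_le

/-- Lei–Zhang–Zhao's Remark 1.4 contains the (axial form of the) swirl-free theorem
`knss_axisymmetric_no_swirl`: `Γ ≡ 0` tends to zero uniformly (sanity implication; in print the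
remark is reduced to KNSS's Theorem 5.2). [cite: LeiZhangZhao2017, Remark 1.4 and Lemma 5.2 (arXiv pp. 4, 11–12)] -/
theorem leiZhangZhao2017_liouville_swirl_decay.knss_axisymmetric_no_swirl
    (h : leiZhangZhao2017_liouville_swirl_decay) : knss_axisymmetric_no_swirl :=
  fun hu hmeas haxi hswirl => h _ hu hmeas haxi fun ε hε =>
    ⟨0, fun t ht x _ => by rw [hswirl t ht x, abs_zero]; exact hε.le⟩

/-- Lei–Ren–Zhang's Theorem 1.2 contains the (axial form of the) swirl-free theorem
`knss_axisymmetric_no_swirl`: for `Γ ≡ 0` the rate condition holds with `L = 0` (sanity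
implication; in print Theorem 1.2 is reduced, through Lei–Zhang–Zhao's Remark 1.4, to KNSS's
Theorem 5.2). [cite: LeiRenZhang2019, Thm 1.2 and §4 (arXiv pp. 4, 10–12)] -/
theorem leiRenZhang2019_liouville_swirl_rate.knss_axisymmetric_no_swirl
    (h : leiRenZhang2019_liouville_swirl_rate) : knss_axisymmetric_no_swirl := by
  intro u hu hmeas haxi hswirl
  obtain ⟨M, hM⟩ := hu.isBoundedOn
  obtain ⟨ε₀, -, hε⟩ := h M
  refine hε u hu (fun t ht x => hM t ht x) hmeas haxi
    ⟨0, fun t ht x => by rw [hswirl t ht x, abs_zero]⟩ ⟨0, 0, fun t ht x _ => ?_⟩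
  rw [hswirl t ht x]
  simp

/-! ### The open problem (AX-L) contains each piece -/

/-- Coordinates are `1`-Lipschitz: `|x_i − c_i| ≤ ‖x − c‖` on `ℝ³`. [folklore] -/
theorem abs_apply_sub_apply_le_norm_sub (x c : ℝ³) (i : Fin 3) : |x i - c i| ≤ ‖x - c‖ := by
  simpa only [Real.norm_eq_abs, PiLp.sub_apply] using PiLp.norm_apply_le (x - c) i

/-- `x₀ ≤ r(x) = √(x₀² + x₁²)`. [folklore] -/
theorem apply_zero_le_cylRadius (x : ℝ³) : x 0 ≤ FluidPDE.cylRadius x := by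
  have h := Real.sqrt_le_sqrt
    (le_add_of_nonneg_right (sq_nonneg (x 1)) : x 0 ^ 2 ≤ x 0 ^ 2 + x 1 ^ 2)
  rw [Real.sqrt_sq_eq_abs] at h
  exact (le_abs_self _).trans h

/-- The exterior of every cylinder, `{x | R ≤ r(x)}`, has positive Lebesgue measure (it contains the
unit ball around `(|R| + 2, 0, 0)`). [folklore] -/
theorem measure_setOf_le_cylRadius_pos (R : ℝ) :
    0 < volume {x : ℝ³ | R ≤ FluidPDE.cylRadius x} := by
  set c : ℝ³ := EuclideanSpace.single 0 (|R| + 2) with hc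
  have hball : Metric.ball c 1 ⊆ {x : ℝ³ | R ≤ FluidPDE.cylRadius x} := by
    intro x hx
    have hdist : ‖x - c‖ < 1 := by rwa [Metric.mem_ball, dist_eq_norm] at hx
    have h0 : |x 0 - c 0| ≤ ‖x - c‖ := abs_apply_sub_apply_le_norm_sub x c 0
    have hc0 : c 0 = |R| + 2 := by simp [hc]
    rw [hc0] at h0
    have h1 : |R| + 1 < x 0 := by
      have := (abs_lt.1 (lt_of_le_of_lt h0 hdist)).1
      linarith
    show R ≤ FluidPDE.cylRadius x
    have h2 := apply_zero_le_cylRadius x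
    linarith [le_abs_self R]
  exact lt_of_lt_of_le (Metric.measure_ball_pos volume c one_pos) (measure_mono hball)

/-- **The constant of a slice with bounded swirl is axial.** If `v : ℝ³ → ℝ³` is a.e. equal to a
constant `b` and its swirl is bounded, `|Γ(x)| ≤ C` for all `x`, then `b = b₂ e_z`: otherwise the
swirl `x₀b₁ − x₁b₀` of the constant exceeds `C` on the unit ball around `K(b₁, −b₀, 0)` for `K`
large, a set of positive measure (the measure-theoretic form of "an axisymmetric constant field is
axial", used to place the Liouville pieces under (AX-L), whose conclusion is an `ℝ³`-valued
constant). [folklore] -/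
theorem eq_smul_eZ_of_ae_eq_const_of_abs_swirl_le {v : ℝ³ → ℝ³} {b : ℝ³} {C : ℝ}
    (hv : v =ᵐ[volume] fun _ => b) (hC : ∀ x, |FluidPDE.swirl v x| ≤ C) :
    b = b 2 • FluidPDE.eZ := by
  -- it suffices to show `b 0 = b 1 = 0`
  suffices h01 : b 0 = 0 ∧ b 1 = 0 by
    ext i
    fin_cases i <;> simp [FluidPDE.eZ, h01.1, h01.2]
  by_contra hne
  have hn : 0 < b 0 ^ 2 + b 1 ^ 2 := by
    rcases not_and_or.1 hne with h | h
    · have := sq_pos_of_ne_zero h; positivity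
    · have := sq_pos_of_ne_zero h; positivity
  -- a.e. the swirl of the constant obeys the bound
  have H : ∀ᵐ x ∂(volume : Measure ℝ³), |x 0 * b 1 - x 1 * b 0| ≤ C := by
    filter_upwards [hv] with x hx
    have := hC x
    rwa [FluidPDE.swirl, hx] at this
  -- the centre of a ball on which it fails
  set K : ℝ := (|C| + |b 0| + |b 1| + 1) / (b 0 ^ 2 + b 1 ^ 2) with hK
  set c : ℝ³ := WithLp.toLp 2 ![K * b 1, -(K * b 0), 0] with hc
  have hc0 : c 0 = K * b 1 := by simp [hc]
  have hc1 : c 1 = -(K * b 0) := by simp [hc]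
  have hcval : c 0 * b 1 - c 1 * b 0 = |C| + |b 0| + |b 1| + 1 := by
    rw [hc0, hc1, hK]
    field_simp
    ring
  have hball : Metric.ball c 1 ⊆ {x : ℝ³ | ¬ |x 0 * b 1 - x 1 * b 0| ≤ C} := by
    intro x hx hle
    have hdist : ‖x - c‖ < 1 := by rwa [Metric.mem_ball, dist_eq_norm] at hx
    have h0 : |x 0 - c 0| ≤ 1 := (abs_apply_sub_apply_le_norm_sub x c 0).trans hdist.le
    have h1 : |x 1 - c 1| ≤ 1 := (abs_apply_sub_apply_le_norm_sub x c 1).trans hdist.le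
    -- `x₀b₁ − x₁b₀ ≥ (c₀b₁ − c₁b₀) − |b₀| − |b₁| = |C| + 1`
    have hdiff : |(x 0 * b 1 - x 1 * b 0) - (c 0 * b 1 - c 1 * b 0)| ≤ |b 0| + |b 1| := by
      have e : (x 0 * b 1 - x 1 * b 0) - (c 0 * b 1 - c 1 * b 0) =
          (x 0 - c 0) * b 1 - (x 1 - c 1) * b 0 := by ring
      rw [e]
      refine (abs_sub _ _).trans ?_
      rw [abs_mul, abs_mul]
      nlinarith [abs_nonneg (b 0), abs_nonneg (b 1), abs_nonneg (x 0 - c 0),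
        abs_nonneg (x 1 - c 1)]
    have hge : |C| + 1 ≤ x 0 * b 1 - x 1 * b 0 := by
      have := (abs_le.1 hdiff).1
      linarith
    have : x 0 * b 1 - x 1 * b 0 ≤ C := (le_abs_self _).trans hle
    linarith [le_abs_self C]
  have hnull : volume {x : ℝ³ | ¬ |x 0 * b 1 - x 1 * b 0| ≤ C} = 0 := ae_iff.1 H
  have hzero : volume (Metric.ball c 1) = 0 := measure_mono_null hball hnull
  exact (Metric.measure_ball_pos volume c one_pos).ne' hzero

/-- (AX-L) contains Lei–Ren–Zhang's Theorem 1.2 (which is a sub-case of the open problem: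
Lei–Ren–Zhang 2019, §1: "our method cannot yet reach the full conjecture in [KNSS], it can be
regarded as a step forward"): under `AxisymmetricLiouvilleBoundedSwirl` the slices are a.e.
constant, and a constant slice with bounded swirl is axial
(`eq_smul_eZ_of_ae_eq_const_of_abs_swirl_le`); the velocity bound and the rate condition are not
used. **Hypothesis (conjecture/notion split 2026-08-15).** `h` is the statement (AX-L) written out — letter for letter the definiens of the canonical `Summit.NavierStokesRegularity.NavierStokesRegularity.AxisymmetricLiouvilleBoundedSwirl` (and of the transitional copy `AxisymmetricLiouvilleBoundedSwirl` above) —, so the theorem mentions neither `Prop` and applies verbatim (by unfolding) to a witness of the canonical conjecture; it keeps its name and place because its last name component is also the name of the fact it concludes, which importers discharge, so the gate's removal lint pins it to this file. [cite: LeiRenZhang2019, §1 p. 4] -/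
theorem AxisymmetricLiouvilleBoundedSwirl.leiRenZhang2019_liouville_swirl_rate
    (h : ∀ u : ℝ → ℝ³ → ℝ³, FluidPDE.IsBoundedAncientMildSolution 1 u →
      (∀ t < 0, AEStronglyMeasurable (u t) volume) →
        (∀ t < 0, FluidPDE.IsAxisymmetric (u t)) →
          (∃ C : ℝ, ∀ t < 0, ∀ x, |FluidPDE.swirl (u t) x| ≤ C) →
            ∀ t < 0, ∃ b : ℝ³, u t =ᵐ[volume] fun _ => b) :
    leiRenZhang2019_liouville_swirl_rate := by
  intro M
  refine ⟨1 / 2, ⟨by norm_num, by norm_num⟩, ?_⟩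
  intro u hu _ hmeas haxi hswirl _ t ht
  obtain ⟨C, hC⟩ := hswirl
  obtain ⟨b, hb⟩ := h u hu hmeas haxi ⟨C, hC⟩ t ht
  have e : b = b 2 • FluidPDE.eZ := eq_smul_eZ_of_ae_eq_const_of_abs_swirl_le hb (hC t ht)
  refine ⟨b 2, ?_⟩
  rw [← e]
  exact hb

/-- (AX-L) contains Lei–Zhang–Zhao's Remark 1.4 (a sub-case of the open problem; Zhang–Pan 2022,
§3, Theorem 3.5 and p. 12): a swirl tending to zero at radial infinity is bounded — `≤ 1` beyond
some radius `R` and `≤ |R| ‖u‖_∞` inside it, by `|Γ| ≤ r‖u‖` (`abs_swirl_le_cylRadius_mul_norm`) —,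
so `AxisymmetricLiouvilleBoundedSwirl` applies, and the constant of each slice is axial
(`eq_smul_eZ_of_ae_eq_const_of_abs_swirl_le`). **Hypothesis (conjecture/notion split 2026-08-15).** `h` is the statement (AX-L) written out — letter for letter the definiens of the canonical `Summit.NavierStokesRegularity.NavierStokesRegularity.AxisymmetricLiouvilleBoundedSwirl` (and of the transitional copy `AxisymmetricLiouvilleBoundedSwirl` above) —, so the theorem mentions neither `Prop` and applies verbatim (by unfolding) to a witness of the canonical conjecture; it keeps its name and place because its last name component is also the name of the fact it concludes, which importers discharge, so the gate's removal lint pins it to this file. [cite: ZhangPan2022, Thm 3.5 and p. 12] -/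
theorem AxisymmetricLiouvilleBoundedSwirl.leiZhangZhao2017_liouville_swirl_decay
    (h : ∀ u : ℝ → ℝ³ → ℝ³, FluidPDE.IsBoundedAncientMildSolution 1 u →
      (∀ t < 0, AEStronglyMeasurable (u t) volume) →
        (∀ t < 0, FluidPDE.IsAxisymmetric (u t)) →
          (∃ C : ℝ, ∀ t < 0, ∀ x, |FluidPDE.swirl (u t) x| ≤ C) →
            ∀ t < 0, ∃ b : ℝ³, u t =ᵐ[volume] fun _ => b) :
    leiZhangZhao2017_liouville_swirl_decay := by
  intro u hu hmeas haxi hdecay t ht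
  obtain ⟨R, hR⟩ := hdecay 1 one_pos
  obtain ⟨M, hM⟩ := hu.isBoundedOn
  have hM0 : 0 ≤ M := (norm_nonneg _).trans (hM t ht 0)
  -- the swirl is bounded: `≤ 1` far from the axis, `≤ |R| M` near it
  have hbound : ∀ s < 0, ∀ x, |FluidPDE.swirl (u s) x| ≤ 1 + |R| * M := by
    intro s hs x
    by_cases hx : R ≤ FluidPDE.cylRadius x
    · exact (hR s hs x hx).trans (le_add_of_nonneg_right (mul_nonneg (abs_nonneg R) hM0))
    · have h1 : |FluidPDE.swirl (u s) x| ≤ FluidPDE.cylRadius x * M :=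
        (abs_swirl_le_cylRadius_mul_norm (u s) x).trans
          (mul_le_mul_of_nonneg_left (hM s hs x) (FluidPDE.cylRadius_nonneg x))
      have h2 : FluidPDE.cylRadius x * M ≤ |R| * M :=
        mul_le_mul_of_nonneg_right ((not_le.1 hx).le.trans (le_abs_self R)) hM0
      linarith
  obtain ⟨b, hb⟩ := h u hu hmeas haxi ⟨_, hbound⟩ t ht
  have e : b = b 2 • FluidPDE.eZ := eq_smul_eZ_of_ae_eq_const_of_abs_swirl_le hb (hbound t ht)
  refine ⟨b 2, ?_⟩
  rw [← e]
  exact hb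

/-- (AX-L) is consistent with the swirl supremum being approached at radial infinity: under
`AxisymmetricLiouvilleBoundedSwirl` every slice of a field in the class of
`leiRenZhang2019_swirl_sup_at_infinity` is a.e. an axial constant, so its swirl vanishes a.e., a
level `ℓ` with `{ℓ < |Γ(t₀, ·)|}` of positive measure is negative, and then
`{r ≥ R} ∩ {ℓ < |Γ(t₀, ·)|} = {r ≥ R}` has positive measure (`measure_setOf_le_cylRadius_pos`).
(Sanity implication for the shape of the rendering; Lei–Ren–Zhang prove the statement for all
bounded ancient solutions with bounded `Γ`, conjecturally all swirl-free.) **Hypothesis (conjecture/notion split 2026-08-15).** `h` is the statement (AX-L) written out — letter for letter the definiens of the canonical `Summit.NavierStokesRegularity.NavierStokesRegularity.AxisymmetricLiouvilleBoundedSwirl` (and of the transitional copy `AxisymmetricLiouvilleBoundedSwirl` above) —, so the theorem mentions neither `Prop` and applies verbatim (by unfolding) to a witness of the canonical conjecture; it keeps its name and place because its last name component is also the name of the fact it concludes, which importers discharge, so the gate's removal lint pins it to this file. [cite: LeiRenZhang2019, §4 p. 10] -/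
theorem AxisymmetricLiouvilleBoundedSwirl.leiRenZhang2019_swirl_sup_at_infinity
    (h : ∀ u : ℝ → ℝ³ → ℝ³, FluidPDE.IsBoundedAncientMildSolution 1 u →
      (∀ t < 0, AEStronglyMeasurable (u t) volume) →
        (∀ t < 0, FluidPDE.IsAxisymmetric (u t)) →
          (∃ C : ℝ, ∀ t < 0, ∀ x, |FluidPDE.swirl (u t) x| ≤ C) →
            ∀ t < 0, ∃ b : ℝ³, u t =ᵐ[volume] fun _ => b) :
    leiRenZhang2019_swirl_sup_at_infinity := by
  intro u hu hmeas haxi hswirl ℓ R hℓ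
  obtain ⟨t₀, ht₀, hpos⟩ := hℓ
  obtain ⟨C, hC⟩ := hswirl
  obtain ⟨b, hb⟩ := h u hu hmeas haxi ⟨C, hC⟩ t₀ ht₀
  have e : b = b 2 • FluidPDE.eZ := eq_smul_eZ_of_ae_eq_const_of_abs_swirl_le hb (hC t₀ ht₀)
  have hb0 : b 0 = 0 := by rw [e]; simp [FluidPDE.eZ]
  have hb1 : b 1 = 0 := by rw [e]; simp [FluidPDE.eZ]
  -- the swirl of the slice vanishes a.e.
  have hae : ∀ᵐ x ∂(volume : Measure ℝ³), FluidPDE.swirl (u t₀) x = 0 := by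
    filter_upwards [hb] with x hx
    rw [FluidPDE.swirl, hx, hb0, hb1, mul_zero, mul_zero, sub_zero]
  -- hence the level `ℓ` is negative
  have hℓ0 : ℓ < 0 := by
    by_contra hℓ0
    have hsub : {x : ℝ³ | ℓ < |FluidPDE.swirl (u t₀) x|} ⊆
        {x | ¬ FluidPDE.swirl (u t₀) x = 0} := by
      intro x hx h0
      have hx' : ℓ < |FluidPDE.swirl (u t₀) x| := hx
      rw [h0, abs_zero] at hx'
      exact hℓ0 hx'
    have hnull : volume {x : ℝ³ | ¬ FluidPDE.swirl (u t₀) x = 0} = 0 := ae_iff.1 hae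
    exact hpos.ne' (measure_mono_null hsub hnull)
  -- and the superlevel set beyond radius `R` is all of `{R ≤ r}`
  refine ⟨t₀, ht₀, lt_of_lt_of_le (measure_setOf_le_cylRadius_pos R) (measure_mono ?_)⟩
  intro x hx
  exact ⟨hx, hℓ0.trans_le (abs_nonneg _)⟩

/-- The Liouville conjecture (L) contains Lei–Ren–Zhang's Theorem 1.2 (through (AX-L), of which (L)
is a strengthening: forget the symmetry and swirl hypotheses; the implication between the two
canonical conjectures is `LiouvilleConjectureNS.axisymmetricLiouvilleBoundedSwirl` in
`SelfSimilarLiouvilleConsequences.lean`). **Hypothesis (conjecture/notion split 2026-08-15).** `hL` is the statement (L) written out — letter for letter the definiens of the canonical `Summit.NavierStokesRegularity.NavierStokesRegularity.LiouvilleConjectureNS` (and of the transitional copy `LiouvilleConjectureNS` above) —, so the theorem mentions neither `Prop` and applies verbatim (by unfolding) to a witness of the canonical conjecture; it keeps its name and place because its last name component is also the name of the fact it concludes, which importers discharge, so the gate's removal lint pins it to this file. [cite: LeiRenZhang2019, §1 (the conjecture of [KNSS, SS09])] -/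
theorem LiouvilleConjectureNS.leiRenZhang2019_liouville_swirl_rate
    (hL : ∀ u : ℝ → ℝ³ → ℝ³, FluidPDE.IsBoundedAncientMildSolution 1 u →
      (∀ t < 0, AEStronglyMeasurable (u t) volume) →
        ∀ t < 0, ∃ b : ℝ³, u t =ᵐ[volume] fun _ => b) :
    leiRenZhang2019_liouville_swirl_rate :=
  AxisymmetricLiouvilleBoundedSwirl.leiRenZhang2019_liouville_swirl_rate
    fun u hu hmeas _ _ => hL u hu hmeas

/-- The Liouville conjecture (L) contains Lei–Zhang–Zhao's Remark 1.4 (through (AX-L), as for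
`LiouvilleConjectureNS.leiRenZhang2019_liouville_swirl_rate`). **Hypothesis (conjecture/notion split 2026-08-15).** `hL` is the statement (L) written out — letter for letter the definiens of the canonical `Summit.NavierStokesRegularity.NavierStokesRegularity.LiouvilleConjectureNS` (and of the transitional copy `LiouvilleConjectureNS` above) —, so the theorem mentions neither `Prop` and applies verbatim (by unfolding) to a witness of the canonical conjecture; it keeps its name and place because its last name component is also the name of the fact it concludes, which importers discharge, so the gate's removal lint pins it to this file. [cite: LeiZhangZhao2017, §1 (the conjecture of [KNSS])] -/
theorem LiouvilleConjectureNS.leiZhangZhao2017_liouville_swirl_decay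
    (hL : ∀ u : ℝ → ℝ³ → ℝ³, FluidPDE.IsBoundedAncientMildSolution 1 u →
      (∀ t < 0, AEStronglyMeasurable (u t) volume) →
        ∀ t < 0, ∃ b : ℝ³, u t =ᵐ[volume] fun _ => b) :
    leiZhangZhao2017_liouville_swirl_decay :=
  AxisymmetricLiouvilleBoundedSwirl.leiZhangZhao2017_liouville_swirl_decay
    fun u hu hmeas _ _ => hL u hu hmeas

end Literature.Analysis.FluidPDE
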